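import Mathlib
import Literature.MathematicalPhysics.QuantumFieldTheory.Balaban1983to89.Dag
import Literature.MathematicalPhysics.QuantumFieldTheory.Balaban1983to89.Step
import Literature.MathematicalPhysics.QuantumFieldTheory.Balaban1983to89.B13
import Literature.MathematicalPhysics.QuantumFieldTheory.Balaban1983to89.B14
import Literature.MathematicalPhysics.QuantumFieldTheory.Balaban1983to89.B16
import Literature.MathematicalPhysics.QuantumFieldTheory.Balaban1983to89.FlowStep
import Literature.MathematicalPhysics.QuantumFieldTheory.Balaban1983to89.B4
import Literature.MathematicalPhysics.QuantumFieldTheory.Balaban1983to89.B5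
import Literature.MathematicalPhysics.QuantumFieldTheory.Balaban1983to89.B6
import Literature.MathematicalPhysics.QuantumFieldTheory.Balaban1983to89.B7
import Literature.MathematicalPhysics.QuantumFieldTheory.Balaban1983to89.B8
import Literature.MathematicalPhysics.QuantumFieldTheory.Balaban1983to89.B8SectGH
import Literature.MathematicalPhysics.QuantumFieldTheory.Balaban1983to89.B9
import Literature.MathematicalPhysics.QuantumFieldTheory.Balaban1983to89.B10
import Literature.MathematicalPhysics.QuantumFieldTheory.Balaban1983to89.B11
import Literature.MathematicalPhysics.QuantumFieldTheory.Balaban1983to89.B12Sec2to5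
import Literature.MathematicalPhysics.QuantumFieldTheory.Balaban1983to89.B15BasicStep
import Literature.MathematicalPhysics.QuantumFieldTheory.Balaban1983to89.B9Thm314
import Literature.MathematicalPhysics.QuantumFieldTheory.Balaban1983to89.B6Lemma21Repaired
import Literature.MathematicalPhysics.QuantumFieldTheory.Balaban1983to89.B16B10Shape
import Literature.MathematicalPhysics.QuantumFieldTheory.Balaban1983to89.StepInhabited
import Literature.MathematicalPhysics.QuantumFieldTheory.Balaban1983to89.B6Lemma21TwoScale

/-!
# `Balaban1983to89.DagBinding` — the citation DAG of [Balaban1983RegularityDecay]–[Balaban1989LargeFieldII] bound to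
the typed statements of the per-paper modules (END and FLOW side), v10.2a

CITATION HEADER (lean-in-tree rule 2026-08-18; audit cell `pub-balaban`, CARVER seat).  `…Balaban1983to89.Dag` states
the citation DAG of T. Bałaban's lattice Yang–Mills ultraviolet-stability series over ABSTRACT leaves (`Dag.Leaves`,
22 propositions).  This module BINDS the leaves that the landed per-paper modules already type, for ONE construction
and ONE run at a time, and proves what the binding makes provable.  Bound here ("END and FLOW side"):

* `smallCouplings` ↦ `Flow.InInterval γ K` of the run's flow ([Balaban1987RG1] Thm 1/3 hypothesis, `Setup`);
* `rgFlow` ↦ `Flow.SatisfiesRG K` ((0.20) of [Balaban1987RG1]; = `Step.RGEq`, `Step.rgEq_iff`);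
* `thm2Regime` ↦ `Thm2RegimeOf (flow) K γ g` := "`0 < g ≤ γ`, the run ENDS at the renormalized coupling, `g_K = g`,
  and its couplings are positive" — the per-run content of the regime of [Balaban1987RG1] Thm 2 p. 259 ("there exists
  a bare coupling constant g₀ = g₀(ε, g) such that … g_K = g"); the EXISTENCE of such a bare coupling for every
  `ε = L^{-K}` is NOT a per-run statement and is isolated below as the hypothesis `EndpointExistence` (v2, new);
* `running` ↦ `B14.H033LogRunning L g (b / log L) (β⁺ / log L)` ((0.31) of [Balaban1987RG1] with
  `log(L^k ε)⁻¹ = (K − k) log L`; in Bałaban's normalisation the (0.31) constants are `β = b / log L`,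
  `β′ = β⁺ / log L`, cf. `Step.logRunning_iff_discrete031`);
* `betaSmoothBounded` ↦ the UNIFORM UPPER BOUND `β_{j+1}(g_j) ≤ β⁺` along the flow ([Balaban1987RG1] p. 264 prints
  "smooth … uniformly bounded … together with all derivatives"; only the bound is used downstream, smoothness is not
  encoded);
* `betaPositive` ↦ `∀ j < K, b ≤ β_{j+1}(g_j)` with ONE constant `b > 0` of the world (v2: uniform in the run, as the
  ε-uniformity of (0.31) requires) — the located UNPRINTED input (cell census T09.F, GAPS.md G-f2.2 / G-r2.1);
* `flowControl` ↦ `B14.FlowIneq26` = (2.6) of [Balaban1988Convergent] p. 255 with `β′ = β⁺`;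
* `smallFieldInductive` ↦ `∀ k ≤ K, IndAss k` ([Balaban1987RG1] Thm 3's conclusion for the run, `B12.RunData.IndAss`);
* `densitiesDescribed` ↦ `∀ k ≤ K, Sect2Form k` ([Balaban1989LargeFieldII] Thm 1's conclusion, `B16.RunData.Sect2Form`);
* `uvBounds` ↦ `∀ k ≤ K, ∀ V, B16.UVIneq … k V E₋ E₊` ((0.1) of [Balaban1989LargeFieldII] with FIXED `E₋, E₊`).

READING OF THE β-LEAVES (cell GAPS.md G-ref2-1 / G-adv2-4).  `(w.C P).flow.β (j+1)` is the (j+1)-st β-function OF THE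
RUN `P`: in print β_{j+1} depends on the earlier couplings `g_0, …, g_{j-1}` as well ([Balaban1987RG1] (1.22) p. 264,
"functions of the previous coupling constants"); the run's `Flow` carries the curried section with those couplings
plugged in, so NO Markov property of the β-family is assumed anywhere in this module.  The world-level hypothesis
`BetaBoundsInInterval` states the two-sided bound `b ≤ β_{j+1}(x) ≤ β⁺` for `x ∈ ]0, γ₀]` ONLY along histories that
stayed in `]0, γ₀]` — the faithful typed form of p. 264 (upper) + T09.F (lower); at the level of the β-FAMILY itself
(histories `Fin (k+1) → ℝ`, the printed one-loop split) the same input is typed in the sibling `…B12Beta` (row P12a),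
and the forward-shooting existence argument is the strategist's `FlowStep` line — neither is imported or restated here.

Left ABSTRACT (the structure `Upstream`, per run): the conclusion blocks `b4 … b13` of the papers B4–B13 and the 𝐑
operation leaves `rOperation`, `rBasicStep` — their typed forms live in `…B4` … `…B15` over paper-specific carriers
that a later refinement may plug in field by field (cell LEMMAS.md, PHASE-2 rows P04–P15); nothing here depends on how
they are bound.  (v3: `Upstream.ofPrinted` plugs in the landed module-level bundles for `b4`–`b8`, `b10`, `b12`, `b13`;
`b9`, `b11` — typed theorem by theorem over several carriers in `…B9`, `…B11`, no single bundle predicate — and the two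
𝐑 leaves stay parameters.  v4: `Upstream.ofPrintedR` binds `b8` to the FAITHFUL Sect. G/H forms of `…B8SectGH` — Prop. 7 with
all three members of (1.140), Thm 8 with the membership binder f ∈ R(U₀) at the printed γ = 1 — over the carrier
extension `PrintedCarriersR`; the r1-typed leaf implies the faithful one (`ofPrintedR_b8_of_ofPrinted`), never conversely.
 v5: `Upstream.ofPrintedFull` binds `b9` and `b11` as well — to the CONJUNCTIONS `B9Leaf` / `B11Leaf` of the printed
propositions of `…B9` (Thms 3.1–3.15, Sects. A–B in the form `B9.sectsAC_architecture` concludes) and `…B11` (Thm 1,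
Props 2–9, Sect. F) over the carrier records `PrintedCarriers9` / `PrintedCarriers11`; only the two 𝐑 leaves stay parameters.
 v6: `Upstream.ofPrintedAll` binds the two 𝐑 leaves too — `rOperation` to `B14.RAssumedP244` ([Balaban1988Convergent]
p. 244, the assumed property of 𝐑) by name over `PrintedCarriers14R`, `rBasicStep` to the conjunction `B15Leaf` of the
printed statements of `…B15`/`…B15.BasicStep` ((0.4), (0.6), Prop. 1, (1.80), (1.89), (1.102)) over `PrintedCarriers15`;
no `Prop` parameter remains.
 v7: `Upstream.ofPrintedAllX` offers the EXTENDED B9 leaf `B9LeafX` = `B9Leaf` ∧ the printed displayed claims (3.49)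
`B9.Stmt349Printed` and (3.132) `B9.Stmt3132Printed` ∧ the local Theorem 3.14 reading `B9Thm314.Thm314LocalPrinted`, over
`PrintedCarriers9X extends PrintedCarriers9` — additive, answering the §(v5) reader remarks G-pv18-4 / G-pv18-5;
v7.1 corrects two consumer names in the §(v7) prose per the reader's DOCFIX G-pv18-6 — docstring-only.
 v8 (append-only; every v7.1 declaration unchanged, a 7-line reader's note appended to the docstring of `Upstream.ofPrinted`):
(a) END side on the PINNED printed form of (B), `B16.EndStatementBPrinted = Thm1Printed ∧ Cor3_250` (`…B16` v5, cell GAPS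
G-pv24-1 / ruling C-r2.23): the binding `leavesP` over `WorldP` carries the (0.1)/(2.50) exponents as DEPENDENCE FUNCTIONS
`em, ep` of the running coupling ([Balaban1988Convergent] Cor. 3 p. 264 "depending on g_k"), and the DAG's (B) over all
runs of such a world IS the pin in both directions (`endStatementBPrinted_of_worldsP` / `worldsP_of_endStatementBPrinted`),
with the headlines `endStatementBPrinted_of_nodesP` / `…_interval` / `sect2Unconditional_of_nodesP`, by-name twins on the
constant-exponent binding, and the kernel-checked honesty note `not_forall_uvStability4D_leaves_of_smallCouplings` (under
the two READER'S HYPOTHESES of `…B16B10Shape` — `LogNormalised` (family-uniform step-0 logarithm, pv24's reading; cell GAPS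
G-pv24-1 (i)–(iii) OPEN; not a printed theorem) and `SmallCouplingsOccur` — the constant-exponent (B) cannot hold for every
run; v10.2a POINTER: that pair AS TYPED is MIS-CUT AT K = 0 — vacuous on forward-generated constructions with non-empty
lattices and sub-unit zero-step densities — and its non-vacuous K-indexed form is
`B16SmallCouplings.not_forall_uvStability4D_leaves_of_betaUpper`, its leaf family instantiated from the series' data in
`B16LeafFamily.not_uvBound01_of_torusLeaves`; see the note in that theorem's docstring below); (b) the B6 leaf with
the constant of Lemma 2.1 a PARAMETER (cell GAPS G-ref1-11 / REFEREE R28; G-A11-1: the literal c₁ = 12·c₀(½α)^d of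
[Balaban1984PropagatorsII] p. 234 is exceeded in d = 4, `B6Lemma21Counterexample.printed_c1_exceeded`): `B6Lemma21Param`
(∃ c₁(α) uniform over the geometries), `B6BlockParam` / `B6BlockRepaired` (the latter on `…B6Lemma21Repaired`), the
one-directional relations printed ⇒ parameter ⇐ repaired, and the re-bound upstream `Upstream.withB6` /
`Upstream.ofPrintedAllXP`; the literal-constant leaf stays on file as the settled negative edge.  v8.1 (docstring-only, no
declaration or cite tag changed): the three prose passages on the honesty note are worded CONDITIONALLY on the reader's
hypotheses `LogNormalised` / `SmallCouplingsOccur` (REFEREE R19 / cell GAPS G-ref2-11 (a) standard: a reader's count is not a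
fact about the print), and `B6Lemma21Param` carries the content note from the v8 review (finite index families).  v9 (append-only; + `import
…StepInhabited`): the `rOperation` leaf consumed over the INHABITED step carrier `Step.DensityRGI` — `ROpLeaf.mapsSpacesI`
(Setup v1.3 vacuity audit: v6's `ROpLeaf.mapsSpaces` is typed over `Step.DensityRG`, whose `RTOp` family is empty for a
non-degenerate Haar datum, `AveragingRT.isEmpty_rtOp_family`; it stays on file, importer-safe) and the bridge
`ROpLeaf.mapsSpaces_of_toI` exhibiting the v6 theorem as the `DensityRG.toI` shadow of the new one.  v10 (THIS
REVISION; append-only, every v9 declaration unchanged): (a) docstring items of the §(v8) cross-read GAPS C-ref6-7 — R1 the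
v8 history line above no longer understates the `Upstream.ofPrinted` note; R2 the four BINDING CONTEXTS `World` ∕ `leaves` ∕
`WorldP` ∕ `leavesP` are dictionaries, not typed printed displays, so their trailing tags are `[folklore]` with the printed
locators kept in the prose; (b) §(v10) the `rOperation` leaf over the inhabited carrier BY NAME, now that `…B14` v4 types the
p. 245 Theorem over `RTOpI` (`B14.ThmP245SpacesI`, B14 lineage, Setup-vacuity MIGRATION row): `ROpLeaf.thmP245SpacesI_iff`
(v9's written-out hypothesis IS `B14.ThmP245SpacesI D.T …`, `Iff.rfl`), `ROpLeaf.mapsSpaces_of_thmP245SpacesI` and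
`ROpLeaf.inSpace_all_of_thmP245SpacesI` (through B14's kernel-checked p. 262 remark `B14.mapsSpaces_of_thmP245SpacesI` ∕
`B14.inSpace_all_of_thmP245SpacesI` — the exact `…I` twins of v6's `ROpLeaf.mapsSpaces`); (c) §(v10b) the PARAMETER-form
`b6` leaf fed by the adv1 lineage's newest certificate (+ `import …B6Lemma21TwoScale`): the TWO-SCALE form of Lemma 2.1
`B6Lemma21TwoScale.Lemma21TwoScale` (cell GAPS G-A13-1 ∕ C-A13-1 = the adv1 lineage's two-scale READING of the count (2.58),
CONTESTED — GAPS G-ref1-18 ∕ G-ref1-19 (b), cell REFEREE.md R40 ∕ R44: under the print's definition of Σ_j as the point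
set Λ_j∩Σ_j, p. 231 ll. 13–15, the printed per-point factor stands; this file takes no side) gives `B6Lemma21Param` with
witness `c₁ = c1TwoScale d δ₀ = 13·c₀(½α)^{4d}` (`b6Lemma21Param_of_twoScale`, `b6BlockParam_of_twoScale`,
`ofPrintedAllXP_b6_of_twoScale`) — whichever reading prevails, the ∃-form leaf absorbs the constant, which is why v8
chose it.  v10.1: docstring-only — the §(v9) section note's sentence on the B14 migration item refreshed per the §(v9)
cross-read (GAPS C-b07g4-2 R1), since `B14.ThmP245SpacesI` landed between v9 and v10.  v10.2: docstring-only — this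
passage and the §(v10b) section note re-worded so that G-A13-1's two-scale reading is recorded as CONTESTED (GAPS
G-ref1-19 (b), REFEREE.md R44.3), not as fact; no declaration, statement or proof changed.  v10.2a: docstring-only —
the three prose passages on the honesty note `not_forall_uvStability4D_leaves_of_smallCouplings` (bullet (a) above, the
END-side module note before `leaves`' END theorems, the theorem's own docstring) now carry a POINTER to the landed and
cross-read siblings `…B16SmallCouplings` v1.1 and `…B16LeafFamily` v1 — which import this module through `…FlowStepRuns`
and therefore cannot be imported here —: the reader's hypothesis pair AS TYPED is mis-cut at K = 0 and its non-vacuous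
K-indexed form lives there (pv24-g4 NOTE 2026-08-19T00:44:24Z, cell GAPS C-pv24g4-1); no declaration, statement, proof,
import or cite tag changed.)

WHAT IS PROVED (bookkeeping only; no statement of the series is asserted):
* `flowStepOfBeta_leaves` — the located step `Dag.FlowStepOfBeta` is DISCHARGED at the bound leaves ((2.6) from the
  RG equations + `0 ≤ β_{j+1}(g_j) ≤ β⁺` + positive couplings, `B14.flowIneq26_of_rg_two_sided`);
* `thm2OfBeta_leaves` (v2) — the located step `Dag.Thm2OfBeta` is DISCHARGED at the bound leaves: the RG equations
  (0.20) telescope (`Step.inv_sq_telescope`) to `1/g_k² = 1/g² + Σ_{j=k}^{K-1} β_{j+1}(g_j)`, so `b ≤ β ≤ β⁺` along the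
  run gives (0.31) with `β = b/log L, β′ = β⁺/log L` (`discrete031_along`) and, with `b ≥ 0` and `g ≤ γ`, the interval
  condition `0 < g_k ≤ γ` (`Step.inInterval_of_discrete031`).  Hence `Dag.B12_Thm2` holds at the bound leaves given the
  three flow leaves, and `uvStability_thm2Regime_leaves`: `Dag.uv_stability_modulo_beta` with BOTH elementary
  reductions discharged — the thirteen paper nodes + (0.20) + the two β-leaves give (B) in the Thm-2 regime of the run;
* `smallField_of_B13step`, `uvStability4D_leaves_iff`, `endStatementB_of_worlds`, `worlds_of_endStatementB`,
  `endStatementB_of_nodes` — as in v1 (the DAG's (B) over all runs of a world IS the readers' `B16.EndStatementB`);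
* `endStatementB_of_nodes_interval` (v2) — the same headline from the WEAKER, faithful β-hypothesis
  `BetaBoundsInInterval` (bounds only on `]0, γ₀]`, history inside the interval), since (B) is conditional on
  `g_k ∈ ]0, γ]`, `γ ≤ γ₀`;
* `thm2Printed_of_endpointExistence` (v2) — [Balaban1987RG1] THEOREM 2 AS PRINTED (`B12.Thm2Printed`, hence
  `B16.Thm2Shape`) SPLITS in the kernel as: (0.20) + `BetaBoundsInInterval` + `EndpointExistence` ⇒ Thm 2, the
  inequality (0.31) being NO additional content.  `EndpointExistence` ("for every small γ, small g and every K some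
  bare coupling g₀ yields a run inside ]0, γ] ending at g_K = g") is the part whose proof "will be given in a separate
  paper" (p. 259) minus (0.31): UNPRINTED; in the cell it is the analytic half of T09.F (forward shooting for the
  history-dependent recursion, seat strat-b12, module `…MissingProofs` for the Markov case) and is NOT claimed here;
* `sect2Unconditional_of_nodes` (v2 HEADLINE) — thirteen paper nodes at the bound leaves for every run + (0.20) +
  `BetaBoundsInInterval γ₀ b β⁺` + `EndpointExistence` ⇒ `B16.Sect2Unconditional` and the bound (0.1) in the
  unconditional form of [Balaban1989LargeFieldII] p. 355 ("Theorem 2 of [I] allows us to remove the assumption on the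
  effective coupling constants"), via `B16.sect2_unconditional_of_Thm2` / `B16.uv_unconditional_of_Thm2`.  Every
  located input is a named hypothesis; the value is the typed skeleton, not progress on the series' claims.

v3 (THIS REVISION, append-only; every v2 declaration unchanged) — THE `FlowStep`-TYPED INPUTS.  The strategist's
module `…FlowStep` types the β-functions WITH HISTORY (`FlowStep.HBeta`: `β k (g_0,…,g_k)` = printed β_{k+1},
[Balaban1987RG1] p. 298), the boxes `]0,γ]^{k+1}` (`FlowStep.Box`), the hypotheses `BetaContH` / `BetaLowerH` /
`BetaUpperH`, and PROVES forward shooting from a bare coupling under `β ≥ 0` (`FlowStep.bare_coupling_exists_of_betaNonneg`).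
This revision is the DICTIONARY between that typing and a construction `C : B12.Construction` and its two bookkeeping
consequences, field to field and with nothing invented:
* `CurriesHBeta C β` — the run's one-variable `β (j+1)` IS `β j` at the run's own earlier couplings (the reading of
  the β-leaves above, now as a named hypothesis); with it `BetaLowerH b γ₀` + `BetaUpperH b′ γ₀` ⇒
  `BetaBoundsInInterval C γ₀ b b′` (`betaBoundsInInterval_of_boxBounds`), and (0.20) per run IS the history recursion
  `FlowStep.RGEqH` (`rgEqH_of_curries`);
* `ForwardGenerated C β` — `FlowStep`'s own generation hypotheses `h0`/`hfwd` for the runs of `C` (the run `(K, m, g₀)`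
  starts at `g_0 = g₀`, (0.18) is solved forward by the positive root); with it `BetaContH γ₀` + `BetaLowerH 0 γ₀` +
  `BetaUpperH β′ γ₀` ⇒ `EndpointExistence C` (`endpointExistence_of_forwardGenerated`: shooting + forward uniqueness,
  the induction of `FlowStep.B12Thm2Shape_of_betaBoundsH` transported to `B12.RunParams`);
* `sect2Unconditional_of_flowStep` (v3 HEADLINE) — `sect2Unconditional_of_nodes` with its two β-side hypotheses
  replaced by the `FlowStep`-typed ones: thirteen nodes + (0.20) + `CurriesHBeta` + `ForwardGenerated` + continuity,
  `b ≤ β ≤ β⁺` on the γ₀-boxes (`b > 0` the world's constant: UNPRINTED, T09.F; continuity / upper bound: p. 264,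
  proofs deferred in print) ⇒ the unconditional §2 form and (0.1).  The β-hypotheses remain LOCATED UNPRINTED INPUTS,
  now consumed in exactly the strategist's typed form; the value is the typed skeleton, not progress on the series.

Units / numbering as in `…Dag` (cell numbers B4–B16 = [8], [10]–[16], [I]–[IV] of the late papers).  Staged
byte-identically in the cell package `run/shared/lean/pub/pub-balaban/lean/BalabanYm4/Literature/…/DagBinding.lean`.
-/

namespace Literature.MathematicalPhysics.QuantumFieldTheory.Balaban1983to89.DagBinding

open Literature.MathematicalPhysics.QuantumFieldTheory.Balaban1983to89

/-! ## The data of one binding -/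

/-- The leaves NOT bound in this module, for one run: the conclusion blocks of B4–B13 (`…B5.Prop11Printed` …
`…B13.SmallFieldStep` over their own carriers) and the 𝐑-operation leaves of
[Balaban1989LargeFieldI]/[Balaban1989LargeFieldII].  Abstract propositions, exactly as in `Dag.Leaves`. [folklore] -/
structure Upstream where
  b4 : Prop
  b5 : Prop
  b6 : Prop
  b7 : Prop
  b8 : Prop
  b9 : Prop
  b10 : Prop
  b11 : Prop
  b12 : Prop
  b13 : Prop
  rOperation : Prop
  rBasicStep : Prop

/-- One binding context ("world"): a construction `C` in the readers' sense (`B16.Construction` = run parameters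
`(K, m, g₀)` ↦ statement-level data, with `d = 4`, the group, `L` and all construction constants fixed inside), the
constants that the end statement and the flow inequalities quantify BEFORE the run — `γ` (interval), `Em, Ep` ((0.1)),
`βup` (= β⁺, upper bound of the β-functions, [Balaban1987RG1] p. 264), `β₀ > 0` ((2.6)), `b > 0` (UNIFORM lower bound
of the β-functions — printed nowhere, cell census T09.F), `L > 1` (block size as a real; (0.1) of [Balaban1987RG1]:
L odd, L > 11), `gR` (the renormalized coupling `g = g_K` of Thm 2 / (0.31)) — and the upstream leaves per run
(locators: [Balaban1989LargeFieldII] Thm 1 + (0.1) pp. 355–356).  A binding context (dictionary), not a printed display.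
[folklore] -/
structure World where
  C : B16.Construction
  γ : ℝ
  Em : ℝ
  Ep : ℝ
  βup : ℝ
  β₀ : ℝ
  β₀_pos : 0 < β₀
  b : ℝ
  b_pos : 0 < b
  L : ℝ
  one_lt_L : 1 < L
  gR : ℝ
  up : B12.RunParams → Upstream

/-- The (0.31) lower coefficient in the world's normalisation: `β = b / log L` (so that `β log(L^k ε)⁻¹ = b (K − k)`). [cite: Balaban1987RG1, (0.31) p.259] -/
noncomputable def World.βlo (w : World) : ℝ := w.b / Real.log w.L

/-- The (0.31) upper coefficient: `β′ = β⁺ / log L`. [cite: Balaban1987RG1, (0.31) p.259] -/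
noncomputable def World.βhi (w : World) : ℝ := w.βup / Real.log w.L

/-- The per-run content of the regime of [Balaban1987RG1] Thm 2 (p. 259: "the sequence of the effective coupling
constants g_k is contained in the interval ]0, γ], and g_K = g", for the bare coupling `g₀(ε, g)`): `0 < g ≤ γ`, the
run ends at `g_K = g`, and its couplings are positive (their being `≤ γ` is then a CONSEQUENCE of `β ≥ 0`, see
`thm2OfBeta_leaves`). [cite: Balaban1987RG1, Thm 2 p.259] -/
def Thm2RegimeOf (F : Flow) (K : ℕ) (γ g : ℝ) : Prop :=
  0 < g ∧ g ≤ γ ∧ F.g K = g ∧ ∀ k, k ≤ K → 0 < F.g k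

/-- THE BINDING: the 22 leaves of the DAG for the world `w` and the run `P` (see the module docstring for the
field-by-field dictionary; `(w.C P).flow : Flow` carries the couplings `g_k` and β-functions of the run; locators:
[Balaban1989LargeFieldII] Thm 1 + (0.1) pp. 355–356).  A binding context (dictionary of the typed leaves), not a printed
display; the printed statements are the `B*` Props it names, each tagged in its own module. [folklore] -/
def leaves (w : World) (P : B12.RunParams) : Dag.Leaves where
  b4 := (w.up P).b4
  b5 := (w.up P).b5
  b6 := (w.up P).b6
  b7 := (w.up P).b7
  b8 := (w.up P).b8
  b9 := (w.up P).b9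
  b10 := (w.up P).b10
  b11 := (w.up P).b11
  b12 := (w.up P).b12
  b13 := (w.up P).b13
  smallFieldInductive := ∀ k, k ≤ P.K → (w.C P).IndAss k
  rOperation := (w.up P).rOperation
  rBasicStep := (w.up P).rBasicStep
  densitiesDescribed := ∀ k, k ≤ P.K → (w.C P).Sect2Form k
  uvBounds := ∀ k, k ≤ P.K → ∀ V : (w.C P).Cfg k, B16.UVIneq (w.C P) k V w.Em w.Ep
  smallCouplings := (w.C P).flow.InInterval w.γ P.K
  thm2Regime := Thm2RegimeOf (w.C P).flow P.K w.γ w.gR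
  running := B14.H033LogRunning w.L w.gR (w.b / Real.log w.L) (w.βup / Real.log w.L) (w.C P).flow P.K
  rgFlow := (w.C P).flow.SatisfiesRG P.K
  betaSmoothBounded := ∀ j, j < P.K → (w.C P).flow.β (j + 1) ((w.C P).flow.g j) ≤ w.βup
  betaPositive := ∀ j, j < P.K → w.b ≤ (w.C P).flow.β (j + 1) ((w.C P).flow.g j)
  flowControl := B14.FlowIneq26 (w.C P).flow.g w.βup w.β₀ P.K

/-- The `running` leaf is (0.31) with the world's coefficients `βlo = b / log L`, `βhi = β⁺ / log L`. [folklore] -/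
theorem running_leaves (w : World) (P : B12.RunParams) :
    (leaves w P).running = B14.H033LogRunning w.L w.gR w.βlo w.βhi (w.C P).flow P.K := rfl

/-! ## Telescoping (0.20) along one run -/

/-- (0.20) summed from `k` to `K` with two-sided bounds ALONG THE RUN: `b ≤ β_{j+1}(g_j) ≤ b′` for `j < K` gives
`1/g_K² + b (K − k) ≤ 1/g_k² ≤ 1/g_K² + b′ (K − k)` — (0.31) in the discrete normalisation `Step.Discrete031`.  Unlike
`Step.discrete031_of_betaBounds` no interval condition on the couplings is needed (the bounds are taken at the points
`g_j` themselves). [cite: Balaban1987RG1, (0.20)/(0.31) pp.258–259] -/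
theorem discrete031_along {K : ℕ} {β : ℕ → ℝ → ℝ} {g : ℕ → ℝ} {b b' : ℝ} (h : Step.RGEq K β g)
    (hlo : ∀ j, j < K → b ≤ β (j + 1) (g j)) (hhi : ∀ j, j < K → β (j + 1) (g j) ≤ b') :
    Step.Discrete031 b b' K (g K) g := by
  intro k hk
  have tel := Step.inv_sq_telescope h hk le_rfl
  have hlo' : ∑ _j ∈ Finset.Ico k K, b ≤ ∑ j ∈ Finset.Ico k K, β (j + 1) (g j) :=
    Finset.sum_le_sum fun j hj => hlo j (Finset.mem_Ico.1 hj).2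
  have hhi' : ∑ j ∈ Finset.Ico k K, β (j + 1) (g j) ≤ ∑ _j ∈ Finset.Ico k K, b' :=
    Finset.sum_le_sum fun j hj => hhi j (Finset.mem_Ico.1 hj).2
  have hc : ∑ _j ∈ Finset.Ico k K, b = b * ((K : ℝ) - k) := by
    rw [Finset.sum_const, Nat.card_Ico, nsmul_eq_mul, Nat.cast_sub hk, mul_comm]
  have hc' : ∑ _j ∈ Finset.Ico k K, b' = b' * ((K : ℝ) - k) := by
    rw [Finset.sum_const, Nat.card_Ico, nsmul_eq_mul, Nat.cast_sub hk, mul_comm]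
  constructor <;> linarith

/-- `B14.H033LogRunning` with coefficients `b / log L`, `b′ / log L` (`L > 1`) IS `Step.Discrete031 b b′`:
`(b / log L) · ((K − k) log L) = b (K − k)`. [cite: Balaban1987RG1, (0.31) p.259] -/
theorem h033LogRunning_iff_discrete031 (L gR b b' : ℝ) (hL : 1 < L) (F : Flow) (K : ℕ) :
    B14.H033LogRunning L gR (b / Real.log L) (b' / Real.log L) F K ↔ Step.Discrete031 b b' K gR F.g := by
  have hlog : Real.log L ≠ 0 := ne_of_gt (Real.log_pos hL)
  have e : ∀ c t : ℝ, c / Real.log L * (t * Real.log L) = c * t := by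
    intro c t
    calc c / Real.log L * (t * Real.log L) = c * t * (Real.log L / Real.log L) := by ring
      _ = c * t := by rw [div_self hlog, mul_one]
  constructor
  · intro h k hk
    have := h k hk
    rw [e, e] at this
    exact this
  · intro h k hk
    have := h k hk
    show 1 / gR ^ 2 + b / Real.log L * (((K : ℝ) - k) * Real.log L) ≤ 1 / (F.g k) ^ 2 ∧
      1 / (F.g k) ^ 2 ≤ 1 / gR ^ 2 + b' / Real.log L * (((K : ℝ) - k) * Real.log L)
    rw [e, e]
    exact this

/-! ## The located flow step (2.6), discharged for the bound leaves -/

/-- (2.6) of [Balaban1988Convergent] p. 255 for one run from: (0.20), `β_{j+1}(g_j) ≤ β⁺`, `b ≤ β_{j+1}(g_j)` with the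
world's `b > 0` (only `0 ≤ β` is used), and positive couplings — by `B14.flowIneq26_of_rg_two_sided` (`β′ = β⁺`, the
world's `β₀ > 0`; for `K = 0` everything is vacuous, else `0 ≤ β⁺` follows from `b ≤ β_1(g_0) ≤ β⁺`). [cite: Balaban1988Convergent, (2.6) p.255] -/
theorem flowIneq26_of_alongRun (w : World) (P : B12.RunParams) (hrg : (w.C P).flow.SatisfiesRG P.K)
    (hhi : ∀ j, j < P.K → (w.C P).flow.β (j + 1) ((w.C P).flow.g j) ≤ w.βup)
    (hlo : ∀ j, j < P.K → w.b ≤ (w.C P).flow.β (j + 1) ((w.C P).flow.g j))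
    (hpos : ∀ k, k ≤ P.K → 0 < (w.C P).flow.g k) :
    B14.FlowIneq26 (w.C P).flow.g w.βup w.β₀ P.K := by
  have hlb : ∀ j, j < P.K → 0 ≤ (w.C P).flow.β (j + 1) ((w.C P).flow.g j) :=
    fun j hj => le_trans (le_of_lt w.b_pos) (hlo j hj)
  by_cases hK : P.K = 0
  · intro m n hmn hnK
    omega
  · have hβup : 0 ≤ w.βup :=
      le_trans (hlb 0 (Nat.pos_of_ne_zero hK)) (hhi 0 (Nat.pos_of_ne_zero hK))
    exact B14.flowIneq26_of_rg_two_sided (w.C P).flow P.K w.βup w.β₀ hβup (le_of_lt w.β₀_pos) hpos hrg hhi hlb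

/-- `Dag.FlowStepOfBeta` HOLDS at the bound leaves. [cite: Balaban1988Convergent, (2.6) p.255] -/
theorem flowStepOfBeta_leaves (w : World) (P : B12.RunParams) : Dag.FlowStepOfBeta (leaves w P) :=
  fun hrg hsb hpos hsc => flowIneq26_of_alongRun w P hrg hsb hpos fun k hk => (hsc k hk).1

/-- Hence the printed-as-used flow step `Dag.FlowStepPrinted` holds at the bound leaves as soon as the three β/RG
leaves do (`Dag.flowStepPrinted_of_beta`). [folklore] -/
theorem flowStepPrinted_leaves (w : World) (P : B12.RunParams)
    (hrg : (leaves w P).rgFlow) (hsb : (leaves w P).betaSmoothBounded) (hpos : (leaves w P).betaPositive) :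
    Dag.FlowStepPrinted (leaves w P) :=
  Dag.flowStepPrinted_of_beta (leaves w P) (flowStepOfBeta_leaves w P) hrg hsb hpos

/-! ## The located step behind Theorem 2's conclusions, discharged for the bound leaves -/

/-- `Dag.Thm2OfBeta` HOLDS at the bound leaves: (0.20) + `b ≤ β_{j+1}(g_j) ≤ β⁺` along the run ⇒ in the Thm-2
regime of the run (`0 < g ≤ γ`, `g_K = g`, positive couplings) the couplings lie in `]0, γ]` and satisfy (0.31) with
`β = b / log L`, `β′ = β⁺ / log L`.  Elementary (telescoping); the existence of a bare coupling realising the regime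
is NOT part of this statement (`EndpointExistence`). [cite: Balaban1987RG1, Thm 2 (0.31) p.259] -/
theorem thm2OfBeta_leaves (w : World) (P : B12.RunParams) : Dag.Thm2OfBeta (leaves w P) := by
  intro hrg hsb hpos hreg
  obtain ⟨hg, hgγ, hK, hposg⟩ := hreg
  have hd : Step.Discrete031 w.b w.βup P.K ((w.C P).flow.g P.K) (w.C P).flow.g :=
    discrete031_along ((Step.rgEq_iff _ _).1 hrg) hpos hsb
  rw [hK] at hd
  refine ⟨?_, ?_⟩
  · exact (Step.inInterval_iff _ _ _).2 (Step.inInterval_of_discrete031 (le_of_lt w.b_pos) hg hgγ hposg hd)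
  · intro k hk
    exact ((h033LogRunning_iff_discrete031 w.L w.gR w.b w.βup w.one_lt_L (w.C P).flow P.K).2 hd) k hk

/-- Hence `Dag.B12_Thm2` (Thm 2's two conclusions for the run, given its regime) holds at the bound leaves as soon as
the three flow leaves do. [cite: Balaban1987RG1, Thm 2 (0.31) p.259] -/
theorem b12Thm2_leaves (w : World) (P : B12.RunParams)
    (hrg : (leaves w P).rgFlow) (hsb : (leaves w P).betaSmoothBounded) (hpos : (leaves w P).betaPositive) :
    Dag.B12_Thm2 (leaves w P) :=
  thm2OfBeta_leaves w P hrg hsb hpos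

/-- `Dag.uv_stability_modulo_beta` with BOTH elementary reductions discharged at the bound leaves: the thirteen paper
nodes + (0.20) + the two β-leaves give (B) for the run in its Thm-2 regime.  Every hypothesis is a named leaf or node;
nothing of the series is asserted. [cite: Balaban1989LargeFieldII, Thm 1 + (0.1) p.355] -/
theorem uvStability_thm2Regime_leaves (w : World) (P : B12.RunParams)
    (h4 : Dag.B4_main (leaves w P)) (h5 : Dag.B5_main (leaves w P)) (h6 : Dag.B6_main (leaves w P))
    (h7 : Dag.B7_main (leaves w P)) (h8 : Dag.B8_main (leaves w P)) (h9 : Dag.B9_main (leaves w P))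
    (h10 : Dag.B10_main (leaves w P)) (h11 : Dag.B11_main (leaves w P)) (h12 : Dag.B12_main (leaves w P))
    (h13 : Dag.B13_main (leaves w P)) (h14 : Dag.B14_main (leaves w P)) (h15 : Dag.B15_main (leaves w P))
    (h16 : Dag.B16_main (leaves w P)) (hrg : (leaves w P).rgFlow) (hsb : (leaves w P).betaSmoothBounded)
    (hpos : (leaves w P).betaPositive) :
    (leaves w P).thm2Regime → (leaves w P).densitiesDescribed ∧ (leaves w P).uvBounds :=
  Dag.uv_stability_modulo_beta (leaves w P) h4 h5 h6 h7 h8 h9 h10 h11 h12 h13 h14 h15 h16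
    (flowStepOfBeta_leaves w P) (thm2OfBeta_leaves w P) hrg hsb hpos

/-! ## The small-field inductive leaf and the module `…B13` -/

/-- How [Balaban1988RG2Cluster]'s delivered inductive step feeds the bound leaf `smallFieldInductive`: base case
`IndAss 0` + `B13.SmallFieldStep` for the run + couplings in the interval ⇒ all inductive assumptions for `k ≤ K`
(`B13.indAss_all`). [cite: Balaban1988RG2Cluster, p.22 (proof of Thm I.3)] -/
theorem smallField_of_B13step (w : World) (P : B12.RunParams) (h0 : (w.C P).IndAss 0)
    (hstep : B13.SmallFieldStep (w.C P).toRunData P.K w.γ) :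
    (leaves w P).smallCouplings → (leaves w P).smallFieldInductive :=
  fun hg => B13.indAss_all (w.C P).toRunData P.K w.γ h0 hstep hg

/-! ## The end statement: the DAG's (B) is the readers' (B) -/

/-- Unfolding: the DAG's end statement at the bound leaves, verbatim in the readers' vocabulary. [folklore] -/
theorem uvStability4D_leaves_iff (w : World) (P : B12.RunParams) :
    Dag.UVStability4D (leaves w P) ↔
      ((w.C P).flow.InInterval w.γ P.K →
        (∀ k, k ≤ P.K → (w.C P).Sect2Form k) ∧
          ∀ k, k ≤ P.K → ∀ V : (w.C P).Cfg k, B16.UVIneq (w.C P) k V w.Em w.Ep) :=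
  Iff.rfl

/-- (B) over all runs of one world ⇒ the pinned end statement `B16.EndStatementB` = [Balaban1989LargeFieldII]
Thm 1 ∧ (0.1) (with this world's `γ`, `E₋`, `E₊` as the witnesses of its existential quantifiers). [cite: Balaban1989LargeFieldII, Thm 1 + (0.1) pp.355–356] -/
theorem endStatementB_of_worlds (w : World) (hγ : 0 < w.γ) (h : ∀ P, Dag.UVStability4D (leaves w P)) :
    B16.EndStatementB w.C :=
  ⟨⟨w.γ, hγ, fun P hP k hk => ((uvStability4D_leaves_iff w P).1 (h P) hP).1 k hk⟩,
    ⟨w.γ, hγ, w.Em, w.Ep, fun P hP k hk V => ((uvStability4D_leaves_iff w P).1 (h P) hP).2 k hk V⟩⟩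

/-- Conversely, `B16.EndStatementB C` yields a world on `C` (with `γ = min γ₁ γ₂` of its two existential constants and
its `E₋, E₊`; the remaining world data arbitrary) in which (B) holds for every run — so the binding loses nothing on
the END side.  Uses only that `Flow.InInterval` is antitone in `γ`. [folklore] -/
theorem worlds_of_endStatementB (C : B16.Construction) (h : B16.EndStatementB C)
    (βup β₀ : ℝ) (hβ₀ : 0 < β₀) (b : ℝ) (hb : 0 < b) (L : ℝ) (hL : 1 < L) (gR : ℝ)
    (up : B12.RunParams → Upstream) :
    ∃ γ Em Ep : ℝ, 0 < γ ∧
      ∀ P, Dag.UVStability4D (leaves ⟨C, γ, Em, Ep, βup, β₀, hβ₀, b, hb, L, hL, gR, up⟩ P) := by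
  obtain ⟨⟨γ₁, hγ₁, H1⟩, ⟨γ₂, hγ₂, Em, Ep, H2⟩⟩ := h
  refine ⟨min γ₁ γ₂, Em, Ep, lt_min hγ₁ hγ₂, fun P => ?_⟩
  rw [uvStability4D_leaves_iff]
  intro hP
  have h1 : (C P).flow.InInterval γ₁ P.K := fun k hk => ⟨(hP k hk).1, le_trans (hP k hk).2 (min_le_left _ _)⟩
  have h2 : (C P).flow.InInterval γ₂ P.K := fun k hk => ⟨(hP k hk).1, le_trans (hP k hk).2 (min_le_right _ _)⟩
  exact ⟨fun k hk => H1 P h1 k hk, fun k hk V => H2 P h2 k hk V⟩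

/-! ## Headline (v1 form): the series' thirteen nodes + RG + bounded, positive β ⇒ the pinned end statement -/

/-- The thirteen paper nodes of the DAG at a leaf assignment (`Dag.B4_main` … `Dag.B16_main`), as one conjunction. [folklore] -/
def Nodes (ℓ : Dag.Leaves) : Prop :=
  Dag.B4_main ℓ ∧ Dag.B5_main ℓ ∧ Dag.B6_main ℓ ∧ Dag.B7_main ℓ ∧ Dag.B8_main ℓ ∧ Dag.B9_main ℓ ∧ Dag.B10_main ℓ ∧
    Dag.B11_main ℓ ∧ Dag.B12_main ℓ ∧ Dag.B13_main ℓ ∧ Dag.B14_main ℓ ∧ Dag.B15_main ℓ ∧ Dag.B16_main ℓ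

/-- `Dag.uv_stability_of_series`, conjunction form. [folklore] -/
theorem uvStability_of_nodes (ℓ : Dag.Leaves) (hn : Nodes ℓ) (hf : Dag.FlowStepPrinted ℓ) :
    Dag.UVStability4D ℓ := by
  obtain ⟨h4, h5, h6, h7, h8, h9, h10, h11, h12, h13, h14, h15, h16⟩ := hn
  exact Dag.uv_stability_of_series ℓ h4 h5 h6 h7 h8 h9 h10 h11 h12 h13 h14 h15 h16 hf

/-- For a world `w` with `γ > 0`: if for every run `P` the thirteen paper nodes hold at the bound leaves, the
couplings satisfy the RG equations (0.20), and the β-functions are bounded above by `β⁺` and below by `b > 0` ALONG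
EVERY RUN, then the pinned end statement `B16.EndStatementB w.C` ([Balaban1989LargeFieldII] Thm 1 ∧ (0.1)) holds.
(See `endStatementB_of_nodes_interval` for the version with β-bounds only on `]0, γ₀]`.) [folklore] -/
theorem endStatementB_of_nodes (w : World) (hγ : 0 < w.γ) (hnodes : ∀ P, Nodes (leaves w P))
    (hrg : ∀ P, (leaves w P).rgFlow) (hsb : ∀ P, (leaves w P).betaSmoothBounded)
    (hpos : ∀ P, (leaves w P).betaPositive) : B16.EndStatementB w.C :=
  endStatementB_of_worlds w hγ fun P =>
    uvStability_of_nodes (leaves w P) (hnodes P) (flowStepPrinted_leaves w P (hrg P) (hsb P) (hpos P))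

/-! ## β-bounds on the interval with history, and the endpoint-existence half of Theorem 2 -/

/-- The two-sided bound on the β-functions in its faithful typed form, for a construction `C` and an interval
`]0, γ₀]`: for every run `P`, every step `j < K` whose EARLIER couplings `g_0, …, g_{j-1}` stayed in `]0, γ₀]`, and
every `x ∈ ]0, γ₀]`: `b ≤ β_{j+1}(x) ≤ b′` (the run's `β (j+1)` is the (j+1)-st β-function with the run's earlier
couplings plugged in, [Balaban1987RG1] (1.22) p. 264).  Upper half: p. 264 "uniformly bounded on this interval"
(proof deferred in print); lower half with `b > 0`: printed NOWHERE in the series (cell census T09.F). [cite: Balaban1987RG1, §1 (1.22) p.264] -/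
def BetaBoundsInInterval (C : B12.Construction) (γ₀ b b' : ℝ) : Prop :=
  ∀ (P : B12.RunParams) (j : ℕ) (x : ℝ), j < P.K →
    (∀ i, i < j → 0 < (C P).flow.g i ∧ (C P).flow.g i ≤ γ₀) → 0 < x → x ≤ γ₀ →
      b ≤ (C P).flow.β (j + 1) x ∧ (C P).flow.β (j + 1) x ≤ b'

/-- The history-free special case: per-run bounds `Step.BetaLower b γ₀`, `Step.BetaUpper b′ γ₀` of the run's β-family
imply `BetaBoundsInInterval`. [folklore] -/
theorem betaBoundsInInterval_of_stepBounds (C : B12.Construction) {γ₀ b b' : ℝ}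
    (h : ∀ P : B12.RunParams, Step.BetaLower b γ₀ (C P).flow.β ∧ Step.BetaUpper b' γ₀ (C P).flow.β) :
    BetaBoundsInInterval C γ₀ b b' :=
  fun P j x _ _ hx hxγ => ⟨(h P).1 (j + 1) x hx hxγ, (h P).2 (j + 1) x hx hxγ⟩

/-- Along a run that stays in `]0, γ]`, `γ ≤ γ₀`, `BetaBoundsInInterval` yields the two bounds AT THE POINTS `g_j`,
`j < K` — the form the telescoping lemmas consume. [folklore] -/
theorem alongRun_of_inInterval (C : B12.Construction) {γ₀ b b' γ : ℝ} (hβ : BetaBoundsInInterval C γ₀ b b')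
    (hγ : γ ≤ γ₀) (P : B12.RunParams) (hI : (C P).flow.InInterval γ P.K) :
    (∀ j, j < P.K → b ≤ (C P).flow.β (j + 1) ((C P).flow.g j)) ∧
      ∀ j, j < P.K → (C P).flow.β (j + 1) ((C P).flow.g j) ≤ b' := by
  have h : ∀ j, j < P.K →
      b ≤ (C P).flow.β (j + 1) ((C P).flow.g j) ∧ (C P).flow.β (j + 1) ((C P).flow.g j) ≤ b' :=
    fun j hj => hβ P j ((C P).flow.g j) hj
      (fun i hi => ⟨(hI i (by omega)).1, le_trans (hI i (by omega)).2 hγ⟩)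
      (hI j hj.le).1 (le_trans (hI j hj.le).2 hγ)
  exact ⟨fun j hj => (h j hj).1, fun j hj => (h j hj).2⟩

/-- THE ENDPOINT-EXISTENCE HALF of [Balaban1987RG1] Theorem 2 (p. 259), for a construction `C` and block size
implicit in `C`: for every torus exponent `m`, all sufficiently small `γ` and `g`, and EVERY `K` (ε = L^{-K}), some
bare coupling `g₀` yields a run whose couplings lie in `]0, γ]` and which ends at `g_K = g` — i.e. `B12.Thm2Printed`
WITHOUT the inequality (0.31) (same quantifier prefix).  "A proof of this theorem … will be given in a separate paper"
(p. 259): UNPRINTED; consumed only as a hypothesis (cell census T09.F, analytic half). [cite: Balaban1987RG1, Thm 2 p.259] -/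
def EndpointExistence (C : B12.Construction) : Prop :=
  ∀ m : ℕ, ∃ γ₂ : ℝ, 0 < γ₂ ∧ ∀ γ : ℝ, 0 < γ → γ ≤ γ₂ →
    ∃ gstar : ℝ, 0 < gstar ∧ ∀ g : ℝ, 0 < g → g ≤ gstar →
      ∀ K : ℕ, ∃ g0 : ℝ, (C ⟨K, m, g0⟩).flow.InInterval γ K ∧ (C ⟨K, m, g0⟩).flow.g K = g

/-- Run by run, what `EndpointExistence` delivers is exactly the bound regime leaf `Thm2RegimeOf`. [folklore] -/
theorem thm2RegimeOf_of_endpoint (F : Flow) (K : ℕ) {γ g : ℝ} (hg : 0 < g) (hgγ : g ≤ γ)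
    (hI : F.InInterval γ K) (hK : F.g K = g) : Thm2RegimeOf F K γ g :=
  ⟨hg, hgγ, hK, fun k hk => (hI k hk).1⟩

/-- [Balaban1987RG1] THEOREM 2 AS PRINTED splits in the kernel: (0.20) for every run + `BetaBoundsInInterval γ₀ b b′`
(`0 < b ≤ b′`) + `EndpointExistence` ⇒ `B12.Thm2Printed C L` (`L > 1`), with the (0.31) constants `β = b / log L`,
`β′ = b′ / log L` and `γ₂` shrunk to `min γ₂ γ₀`.  So (0.31) is NO additional content of Theorem 2 beyond the
β-bounds; the endpoint existence is.  Pure bookkeeping (telescoping + quantifier logic). [cite: Balaban1987RG1, Thm 2 (0.31) p.259] -/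
theorem thm2Printed_of_endpointExistence (C : B12.Construction) {L γ₀ b b' : ℝ} (hL : 1 < L) (hγ₀ : 0 < γ₀)
    (hb : 0 < b) (hbb' : b ≤ b') (hrg : ∀ P : B12.RunParams, (C P).flow.SatisfiesRG P.K)
    (hβ : BetaBoundsInInterval C γ₀ b b') (hex : EndpointExistence C) : B12.Thm2Printed C L := by
  intro m
  obtain ⟨γ₂, hγ₂, H⟩ := hex m
  refine ⟨min γ₂ γ₀, lt_min hγ₂ hγ₀, fun γ hγ hγle => ?_⟩
  obtain ⟨gstar, hgstar, Hg⟩ := H γ hγ (le_trans hγle (min_le_left _ _))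
  have hlog : 0 < Real.log L := Real.log_pos hL
  refine ⟨gstar, hgstar, fun g hg hgle =>
    ⟨b / Real.log L, b' / Real.log L, div_pos hb hlog, div_le_div_of_nonneg_right hbb' hlog.le, fun K => ?_⟩⟩
  obtain ⟨g0, hint, hgK⟩ := Hg g hg hgle K
  refine ⟨g0, hint, hgK, ?_⟩
  have hγ₀' : γ ≤ γ₀ := le_trans hγle (min_le_right _ _)
  obtain ⟨hlo, hhi⟩ := alongRun_of_inInterval C hβ hγ₀' ⟨K, m, g0⟩ hint
  have hR : Step.RGEq K (C ⟨K, m, g0⟩).flow.β (C ⟨K, m, g0⟩).flow.g := (Step.rgEq_iff _ _).1 (hrg ⟨K, m, g0⟩)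
  have hd : Step.Discrete031 b b' K ((C ⟨K, m, g0⟩).flow.g K) (C ⟨K, m, g0⟩).flow.g :=
    discrete031_along hR hlo hhi
  rw [hgK] at hd
  intro k hk
  exact ((h033LogRunning_iff_discrete031 L g b b' hL (C ⟨K, m, g0⟩).flow K).2 hd) k hk

/-! ## Headline (v2 form): faithful β-hypothesis; the unconditional form of (B) modulo the located inputs -/

/-- The pinned end statement from the thirteen nodes at the bound leaves, (0.20), and β-bounds ONLY on `]0, γ₀]`
with history inside the interval (`γ ≤ γ₀`): (B) is conditional on `g_k ∈ ]0, γ]`, along such runs the bounds hold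
at the points `g_j`, and (2.6) follows as in `flowIneq26_of_alongRun`. [cite: Balaban1989LargeFieldII, Thm 1 + (0.1) pp.355–356] -/
theorem endStatementB_of_nodes_interval (w : World) (hγ : 0 < w.γ) {γ₀ : ℝ} (hγ₀ : w.γ ≤ γ₀)
    (hnodes : ∀ P, Nodes (leaves w P)) (hrg : ∀ P, (leaves w P).rgFlow)
    (hβ : BetaBoundsInInterval w.C.toB12 γ₀ w.b w.βup) : B16.EndStatementB w.C := by
  refine endStatementB_of_worlds w hγ fun P => uvStability_of_nodes (leaves w P) (hnodes P) ?_
  intro hsc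
  obtain ⟨hlo, hhi⟩ := alongRun_of_inInterval w.C.toB12 hβ hγ₀ P hsc
  exact flowIneq26_of_alongRun w P (hrg P) hhi hlo fun k hk => (hsc k hk).1

/-- [Balaban1987RG1] Thm 2 in the readers' B16 vocabulary (`B16.Thm2Shape w.C w.L`) from the world's flow data:
(0.20) + `BetaBoundsInInterval γ₀ b β⁺` + `EndpointExistence`. [cite: Balaban1987RG1, Thm 2 (0.31) p.259] -/
theorem thm2Shape_of_world (w : World) {γ₀ : ℝ} (hγ₀ : 0 < γ₀) (hbup : w.b ≤ w.βup)
    (hrg : ∀ P, (leaves w P).rgFlow) (hβ : BetaBoundsInInterval w.C.toB12 γ₀ w.b w.βup)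
    (hex : EndpointExistence w.C.toB12) : B16.Thm2Shape w.C w.L :=
  thm2Printed_of_endpointExistence w.C.toB12 w.one_lt_L hγ₀ w.b_pos hbup (fun P => hrg P) hβ hex

/-- HEADLINE (v2).  For a world `w` with `0 < γ ≤ γ₀` and `b ≤ β⁺`: if for every run the thirteen paper nodes of the
DAG hold at the bound leaves and the couplings satisfy (0.20), if the β-functions obey `b ≤ β ≤ β⁺` on `]0, γ₀]`
along histories inside the interval (upper: [Balaban1987RG1] p. 264, proof deferred; lower: UNPRINTED, T09.F), and if
the endpoint-existence half of [Balaban1987RG1] Thm 2 holds (UNPRINTED, T09.F), then the densities have the §2 form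
and the bound (0.1) holds WITHOUT the coupling hypothesis, in Theorem 2's regime — the unconditional reading claimed on
p. 355 of [Balaban1989LargeFieldII].  Every located input is a named hypothesis; bookkeeping only. [cite: Balaban1989LargeFieldII, p.355] -/
theorem sect2Unconditional_of_nodes (w : World) (hγ : 0 < w.γ) {γ₀ : ℝ} (hγ₀ : w.γ ≤ γ₀) (hbup : w.b ≤ w.βup)
    (hnodes : ∀ P, Nodes (leaves w P)) (hrg : ∀ P, (leaves w P).rgFlow)
    (hβ : BetaBoundsInInterval w.C.toB12 γ₀ w.b w.βup) (hex : EndpointExistence w.C.toB12) :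
    B16.Sect2Unconditional w.C ∧
      ∃ Em Ep : ℝ, ∀ m : ℕ, ∃ gstar : ℝ, 0 < gstar ∧ ∀ g : ℝ, 0 < g → g ≤ gstar →
        ∀ K : ℕ, ∃ g0 : ℝ, (w.C ⟨K, m, g0⟩).flow.g K = g ∧
          ∀ k, k ≤ K → ∀ V : (w.C ⟨K, m, g0⟩).Cfg k, B16.UVIneq (w.C ⟨K, m, g0⟩) k V Em Ep := by
  have hB : B16.EndStatementB w.C := endStatementB_of_nodes_interval w hγ hγ₀ hnodes hrg hβ
  have h2 : B16.Thm2Shape w.C w.L := thm2Shape_of_world w (lt_of_lt_of_le hγ hγ₀) hbup hrg hβ hex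
  exact ⟨B16.sect2_unconditional_of_Thm2 w.C w.L hB.1 h2, B16.uv_unconditional_of_Thm2 w.C w.L hB.2 h2⟩

/-! ## v3: the `FlowStep`-typed inputs — dictionary and the two bookkeeping consequences -/

/-- THE DICTIONARY between a construction's per-run one-variable β-functions (`(C P).flow.β (j+1)`, [Balaban1987RG1]
(0.20) p. 256 / (1.22) p. 264) and a history-dependent family `β : FlowStep.HBeta` (p. 298: "we write β_j as explicitly
dependent on g_{j−1}, although it depends also on all preceding coupling constants"): the run's `β_{j+1}(x)` is `β j`
evaluated at the run's own earlier couplings `g_0, …, g_{j−1}` with `x` in the last slot.  A reading of how `C`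
reports its β-functions, consumed as a hypothesis; no content of the series. [cite: Balaban1987RG1, §5 p.298 and (1.22) p.264] -/
def CurriesHBeta (C : B12.Construction) (β : FlowStep.HBeta) : Prop :=
  ∀ (P : B12.RunParams) (j : ℕ) (x : ℝ), j < P.K →
    (C P).flow.β (j + 1) x = β j (Function.update (FlowStep.prefixOf (C P).flow.g j) (Fin.last j) x)

/-- FORWARD GENERATION of the runs of `C` by the history family `β` — verbatim the hypotheses `h0`, `hfwd` of
`FlowStep.B12Thm2Shape_of_betaBoundsH`, transported from `flowOf : Params → ℝ → Flow` to `C : B12.RunParams → RunData`: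
the run with parameters `(K, m, g₀)` starts at `g_0 = g₀` ([Balaban1987RG1] (0.17) p. 255), and (0.18)/(0.20) is
solved FORWARD by the positive root — whenever `g_0, …, g_k > 0` and `1/g_k² − β_{k+1}(g_0, …, g_k) > 0`, the next
coupling is positive and satisfies `1/g_{k+1}² = 1/g_k² − β_{k+1}(g_0, …, g_k)`. [cite: Balaban1987RG1, (0.17)–(0.20) pp.255–256] -/
def ForwardGenerated (C : B12.Construction) (β : FlowStep.HBeta) : Prop :=
  (∀ P : B12.RunParams, (C P).flow.g 0 = P.g0) ∧
    ∀ (P : B12.RunParams) (k : ℕ), k < P.K → (∀ i, i ≤ k → 0 < (C P).flow.g i) →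
      0 < 1 / ((C P).flow.g k) ^ 2 - β k (FlowStep.prefixOf (C P).flow.g k) →
        0 < (C P).flow.g (k + 1) ∧
          1 / ((C P).flow.g (k + 1)) ^ 2 = 1 / ((C P).flow.g k) ^ 2 - β k (FlowStep.prefixOf (C P).flow.g k)

/-- Plugging the run's own `g_j` into the last slot of its prefix gives the prefix back. [folklore] -/
theorem update_prefixOf_last (g : ℕ → ℝ) (k : ℕ) :
    Function.update (FlowStep.prefixOf g k) (Fin.last k) (g k) = FlowStep.prefixOf g k := by
  funext i
  by_cases hi : i = Fin.last k
  · subst hi; simp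
  · simp [hi]

/-- Under the dictionary, (0.20) for a run (`Flow.SatisfiesRG`) IS the history recursion `FlowStep.RGEqH` for its
couplings. [cite: Balaban1987RG1, (0.20) p.256] -/
theorem rgEqH_of_curries (C : B12.Construction) (β : FlowStep.HBeta) (hcur : CurriesHBeta C β)
    (P : B12.RunParams) (hrg : (C P).flow.SatisfiesRG P.K) : FlowStep.RGEqH P.K β (C P).flow.g := by
  intro k hk
  have h := hrg k hk
  rw [hcur P k _ hk, update_prefixOf_last] at h
  exact h

/-- A prefix whose earlier coordinates are couplings in `]0, γ₀]` and whose last coordinate is `x ∈ ]0, γ₀]` lies in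
the box `]0, γ₀]^{j+1}`. [folklore] -/
theorem update_prefixOf_mem_box {γ₀ : ℝ} {g : ℕ → ℝ} {j : ℕ} {x : ℝ}
    (hist : ∀ i, i < j → 0 < g i ∧ g i ≤ γ₀) (hx : 0 < x) (hxγ : x ≤ γ₀) :
    Function.update (FlowStep.prefixOf g j) (Fin.last j) x ∈ FlowStep.Box γ₀ j := by
  rw [FlowStep.mem_box]
  intro i
  by_cases hi : i = Fin.last j
  · subst hi; simpa using And.intro hx hxγ
  · have hne : (i : ℕ) ≠ j := fun h => hi (Fin.ext (by simp [h]))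
    have hlt : (i : ℕ) < j := by have := i.isLt; omega
    simpa [Function.update_apply, hi] using hist i hlt

/-- `BetaBoundsInInterval` FROM THE `FlowStep` TYPING: under the dictionary, `b ≤ β ≤ b′` on the boxes `]0, γ₀]^{k+1}`
(`FlowStep.BetaLowerH b γ₀`, `FlowStep.BetaUpperH b′ γ₀` — upper: [Balaban1987RG1] p. 264, proof deferred in print;
lower with `b > 0`: UNPRINTED, cell census T09.F) gives the two-sided bound along histories inside the interval. [cite: Balaban1987RG1, §1 (1.22) p.264] -/
theorem betaBoundsInInterval_of_boxBounds (C : B12.Construction) (β : FlowStep.HBeta) {γ₀ b b' : ℝ}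
    (hcur : CurriesHBeta C β) (hlo : FlowStep.BetaLowerH b γ₀ β) (hhi : FlowStep.BetaUpperH b' γ₀ β) :
    BetaBoundsInInterval C γ₀ b b' := by
  intro P j x hj hist hx hxγ
  have hmem := update_prefixOf_mem_box (g := (C P).flow.g) hist hx hxγ
  rw [hcur P j x hj]
  exact ⟨hlo j _ hmem, hhi j _ hmem⟩

/-- `EndpointExistence` FROM THE `FlowStep` TYPING — the endpoint-existence half of [Balaban1987RG1] Theorem 2 for a
forward-generated construction: if the history β-family is continuous on the boxes `]0, γ₀]^{k+1}`, NONNEGATIVE there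
(its sign: UNPRINTED, T09.F) and bounded above by `β′ ≥ 0` (p. 264), then for every `m`, every `γ ≤ γ₀`, every
`g ∈ ]0, γ]` and EVERY `K` the bare coupling `g₀ := gs 0` of the shooting trajectory
(`FlowStep.bare_coupling_exists_of_betaNonneg`) generates a run inside `]0, γ]` ending at `g_K = g` — by forward
uniqueness of the positive root (the induction of `FlowStep.B12Thm2Shape_of_betaBoundsH`).  Bookkeeping over the
strategist's theorem; the β-hypotheses are the located unprinted inputs. [cite: Balaban1987RG1, Thm 2 p.259] -/
theorem endpointExistence_of_forwardGenerated (C : B12.Construction) (β : FlowStep.HBeta) {γ₀ β' : ℝ}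
    (hγ₀ : 0 < γ₀) (hβ' : 0 ≤ β') (hcont : FlowStep.BetaContH γ₀ β) (hsign : FlowStep.BetaLowerH 0 γ₀ β)
    (hhi : FlowStep.BetaUpperH β' γ₀ β) (hgen : ForwardGenerated C β) : EndpointExistence C := by
  intro m
  refine ⟨γ₀, hγ₀, fun γ hγ hγle => ⟨γ, hγ, fun g hg hgle K => ?_⟩⟩
  -- restrict the β-hypotheses from the γ₀-boxes to the γ-boxes
  have hcont' : FlowStep.BetaContH γ β := fun k => (hcont k).mono (FlowStep.box_mono hγle k)
  have hsign' : FlowStep.BetaLowerH 0 γ β := fun k v hv => hsign k v (FlowStep.box_mono hγle k hv)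
  have hhi' : FlowStep.BetaUpperH β' γ β := fun k v hv => hhi k v (FlowStep.box_mono hγle k hv)
  obtain ⟨gs, hgsK, hrg, hI, -⟩ :=
    FlowStep.bare_coupling_exists_of_betaNonneg β hγ hβ' hcont' hsign' hhi' K g hg hgle
  refine ⟨gs 0, ?_⟩
  set P : B12.RunParams := ⟨K, m, gs 0⟩ with hP
  have hPK : P.K = K := rfl
  -- forward uniqueness (strong form: agreement of the whole prefix)
  have agree : ∀ k, k ≤ K → ∀ i, i ≤ k → (C P).flow.g i = gs i := by
    intro k
    induction k with
    | zero => intro _ i hi; obtain rfl := Nat.le_zero.mp hi; exact hgen.1 P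
    | succ k ih =>
      intro hk i hi
      have hkK : k < K := Nat.lt_of_succ_le hk
      rcases Nat.lt_or_eq_of_le hi with hlt | rfl
      · exact ih hkK.le i (Nat.lt_succ_iff.mp hlt)
      · have hprev : ∀ i, i ≤ k → (C P).flow.g i = gs i := ih hkK.le
        have hpre : FlowStep.prefixOf (C P).flow.g k = FlowStep.prefixOf gs k := by
          funext j; simp [FlowStep.prefixOf, hprev j (Nat.lt_succ_iff.mp j.isLt)]
        have hgk : (C P).flow.g k = gs k := hprev k le_rfl
        have hpos_k1 : 0 < gs (k + 1) := (hI (k + 1) hk).1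
        have hrgk : 1 / (gs k) ^ 2 = 1 / (gs (k + 1)) ^ 2 + β k (FlowStep.prefixOf gs k) := hrg k hkK
        have hrhs : 0 < 1 / (gs k) ^ 2 - β k (FlowStep.prefixOf gs k) := by
          rw [hrgk, add_sub_cancel_right]; positivity
        have hposAll : ∀ i, i ≤ k → 0 < (C P).flow.g i :=
          fun i hi => by rw [hprev i hi]; exact (hI i (hi.trans hkK.le)).1
        obtain ⟨hpos', heq'⟩ := hgen.2 P k (hPK ▸ hkK) hposAll (by rw [hgk, hpre]; exact hrhs)
        rw [hgk, hpre, hrgk, add_sub_cancel_right] at heq'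
        have hsq : ((C P).flow.g (k + 1)) ^ 2 = (gs (k + 1)) ^ 2 := by
          have h1 : (((C P).flow.g (k + 1)) ^ 2)⁻¹ = ((gs (k + 1)) ^ 2)⁻¹ := by
            simpa only [one_div] using heq'
          exact inv_inj.mp h1
        exact (pow_left_inj₀ hpos'.le hpos_k1.le (by norm_num)).mp hsq
  have agree' : ∀ k, k ≤ K → (C P).flow.g k = gs k := fun k hk => agree K le_rfl k hk
  refine ⟨?_, ?_⟩
  · intro k hk
    rw [agree' k hk]
    exact hI k hk
  · rw [agree' K le_rfl]; exact hgsK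

/-- HEADLINE (v3).  `sect2Unconditional_of_nodes` with its β-side hypotheses in the strategist's `FlowStep` typing: for
a world `w` with `0 < γ ≤ γ₀` and `b ≤ β⁺`, if for every run the thirteen paper nodes hold at the bound leaves and the
couplings satisfy (0.20), if the runs of `w.C` are forward-generated by a history β-family `β` which the run's
β-functions curry, and if `β` is continuous on the boxes `]0, γ₀]^{k+1}` with `b ≤ β ≤ β⁺` there (continuity and the
upper bound: [Balaban1987RG1] p. 264, proofs deferred in print; the lower bound `b > 0`: UNPRINTED, cell census
T09.F), then the densities have the §2 form and (0.1) holds WITHOUT the coupling hypothesis — the unconditional reading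
of [Balaban1989LargeFieldII] p. 355.  Every located input is a named hypothesis; bookkeeping only. [cite: Balaban1989LargeFieldII, p.355] -/
theorem sect2Unconditional_of_flowStep (w : World) (hγ : 0 < w.γ) {γ₀ : ℝ} (hγ₀ : w.γ ≤ γ₀) (hbup : w.b ≤ w.βup)
    (hnodes : ∀ P, Nodes (leaves w P)) (hrg : ∀ P, (leaves w P).rgFlow) (β : FlowStep.HBeta)
    (hcur : CurriesHBeta w.C.toB12 β) (hgen : ForwardGenerated w.C.toB12 β) (hcont : FlowStep.BetaContH γ₀ β)
    (hlo : FlowStep.BetaLowerH w.b γ₀ β) (hhi : FlowStep.BetaUpperH w.βup γ₀ β) :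
    B16.Sect2Unconditional w.C ∧
      ∃ Em Ep : ℝ, ∀ m : ℕ, ∃ gstar : ℝ, 0 < gstar ∧ ∀ g : ℝ, 0 < g → g ≤ gstar →
        ∀ K : ℕ, ∃ g0 : ℝ, (w.C ⟨K, m, g0⟩).flow.g K = g ∧
          ∀ k, k ≤ K → ∀ V : (w.C ⟨K, m, g0⟩).Cfg k, B16.UVIneq (w.C ⟨K, m, g0⟩) k V Em Ep := by
  have hγ₀pos : 0 < γ₀ := lt_of_lt_of_le hγ hγ₀
  have hβ : BetaBoundsInInterval w.C.toB12 γ₀ w.b w.βup := betaBoundsInInterval_of_boxBounds w.C.toB12 β hcur hlo hhi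
  have hsign : FlowStep.BetaLowerH 0 γ₀ β := fun k v hv => le_trans w.b_pos.le (hlo k v hv)
  have hex : EndpointExistence w.C.toB12 :=
    endpointExistence_of_forwardGenerated w.C.toB12 β hγ₀pos (le_trans w.b_pos.le hbup) hcont hsign hhi hgen
  exact sect2Unconditional_of_nodes w hγ hγ₀ hbup hnodes hrg hβ hex

/-! ## v3: the upstream leaves bound to the landed module bundles -/

/-- The CARRIERS AND CONSTANTS over which the per-paper modules type the conclusion blocks of B4–B8, B10, B12 §§2–5 and
B13 (one group of fields per paper; the index types are the families of instances — lattices, backgrounds, cubes — the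
printed statements quantify over).  Data only. [folklore] -/
structure PrintedCarriers where
  /-- B4 [Balaban1983RegularityDecay]: the three families of `B4.LeafB4` and `(d, N)` of its Sect. 5 Theorem. -/
  I4E : Type
  I4U : Type
  I4F : Type
  famE : I4E → B4.EtaSetting
  famU : I4U → B4.UnitSetting
  famF : I4F → B4.FormSetting
  d4 : ℕ
  N4 : ℕ
  /-- B5 [Balaban1984PropagatorsI]: the family of `B5.MainBlock`. -/
  I5 : Type
  fam5 : I5 → B5.Setting
  forms5 : I5 → B5.FormData
  /-- B6 [Balaban1984PropagatorsII]: the block data of `B6.StatedBlock`. -/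
  D6 : B6.BlockData
  /-- B7 [Balaban1985Averaging]: the constants and five families of `B7.Concl`. -/
  I7a : Type
  I7b : Type
  I7c : Type
  I7d : Type
  I7e : Type
  L7 : ℝ
  c₂ : ℝ
  C₀ : ℝ
  c₂' : ℝ
  one7 : I7a → B7.OneStep
  kst7 : I7b → B7.KStep
  kexp7 : I7c → B7.KExp
  gd7 : I7d → B7.GaugeData
  gone7 : I7e → B7.GaugeOneStep
  /-- B8 [Balaban1985RegularSpaces]: the constants and four families of `B8.Concl`. -/
  I8a : Type
  I8b : Type
  I8c : Type
  I8d : Type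
  d8 : ℕ
  L8 : ℝ
  C₂ : ℝ
  B₁' : ℝ
  B₀' : ℝ
  B₁ : ℝ
  B₂ : ℝ
  c₁ : ℝ
  inp8 : B8.B9Inputs
  B₀β : ℝ
  loc8 : I8a → B8.LocalData
  fam8 : I8b → B8.GFData2
  lan8 : I8c → B8.LandauData
  cub8 : I8d → B8.CubeData
  toAxial8 : ∀ i, (fam8 i).Cfg → (fam8 i).Pert → (fam8 i).Pert
  /-- B10 [Balaban1985UV3]: the family of runs of `B10.Thm1Printed` / `B10.Thm2Printed`. -/
  I10 : Type
  runs10 : I10 → B10.RunData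
  /-- B12 §§2–5 [Balaban1987RG1]: the frame and constants of `B12Sec2to5.Lemma4Printed`. -/
  F12 : B12Sec2to5.Lemma4Frame
  c12 : B12Sec2to5.Lemma4Consts
  /-- B13 [Balaban1988RG2Cluster]: the step data and constants of `B13.Lemma1Printed`–`Lemma3Printed`. -/
  S13 : B13.StepData
  c13 : B13.Consts

/-- THE UPSTREAM BINDING: the leaves `b4`–`b8`, `b10`, `b12`, `b13` ARE the landed module-level bundles of the printed
statements over the chosen carriers — `B4.LeafB4`, `B5.MainBlock`, `B6.StatedBlock`, `B7.Concl`, `B8.Concl`,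
`B10.Thm1Printed ∧ B10.Thm2Printed`, `B12Sec2to5.Lemma4Printed`, `B13.Lemma1Printed ∧ Lemma2Printed ∧ Lemma3Printed`
(one field ↦ one module predicate; nothing invented).  `b9` ([Balaban1985BackgroundPropagators] Thms 3.1–3.15: typed
theorem by theorem as `B9.Thm31Printed` … `B9.Thm315Printed` over `(c35, geo, bg)`), `b11` ([Balaban1985Variational]
Thm 1 + Props. 2–9: `B11.Thm1Printed`, `B11.Prop2Printed` … `B11.Prop9Printed` over four carriers) and the two 𝐑 leaves
(`…B15`, `…B15BasicStep`) have no single bundle predicate and stay parameters.  LATER REVISIONS (read before use): the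
`b8` field here is the r1-typed `B8.Concl` (whose Prop. 7 / Thm 8 forms `Prop7Printed`/`Thm8Printed` are STRONGER than print,
cell DIVERGENCE D-r1g4.1, GAPS G-ref1-8) — superseded as the bound B8 leaf by the FAITHFUL Sect. G/H forms in
`Upstream.ofPrintedR` (v4) / `Upstream.ofPrintedFull` (v5), the old leaf implying the faithful one (`ofPrintedR_b8_of_ofPrinted`),
never conversely; the `b6` field `B6.StatedBlock` carries Lemma 2.1 with the LITERAL constant c₁ = 12·c₀(½α)^d, refuted as
typed for d ≥ 3 (`B6Lemma21Counterexample.printed_c1_exceeded`, cell GAPS G-A11-1 / G-ref1-11) — the PARAMETER form is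
`Upstream.ofPrintedAllXP` (v8).  Kept unchanged for importers. [folklore] -/
def Upstream.ofPrinted (X : PrintedCarriers) (b9 b11 rOperation rBasicStep : Prop) : Upstream where
  b4 := B4.LeafB4 X.famE X.famU X.famF X.d4 X.N4
  b5 := B5.MainBlock X.fam5 X.forms5
  b6 := B6.StatedBlock X.D6
  b7 := B7.Concl X.L7 X.c₂ X.C₀ X.c₂' X.one7 X.kst7 X.kexp7 X.gd7 X.gone7
  b8 := B8.Concl X.d8 X.L8 X.C₂ X.B₁' X.B₀' X.B₁ X.B₂ X.c₁ X.inp8 X.B₀β X.loc8 X.fam8 X.lan8 X.cub8 X.toAxial8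
  b9 := b9
  b10 := B10.Thm1Printed X.runs10 ∧ B10.Thm2Printed X.runs10
  b11 := b11
  b12 := B12Sec2to5.Lemma4Printed X.F12 X.c12
  b13 := B13.Lemma1Printed X.S13 X.c13 ∧ B13.Lemma2Printed X.S13 X.c13 ∧ B13.Lemma3Printed X.S13 X.c13
  rOperation := rOperation
  rBasicStep := rBasicStep

/-- The bound `b6` leaf contains B6's "main technical results" (Prop. 2.6 ∧ Cor. 2.8, p. 249), the sub-block the
B9 base imports (`B6.mainResults_of_statedBlock`). [cite: Balaban1984PropagatorsII, p.249] -/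
theorem ofPrinted_b6_mainResults (X : PrintedCarriers) (b9 b11 rOp rBS : Prop)
    (h : (Upstream.ofPrinted X b9 b11 rOp rBS).b6) : B6.MainResults X.D6 :=
  B6.mainResults_of_statedBlock X.D6 h

/-- The bound `b4` leaf yields B4's Sect. 5 Theorem in its literal printed reading (`B4.leafB4_sect5_literal`). [cite: Balaban1983RegularityDecay, Sect. 5 Theorem p.594] -/
theorem ofPrinted_b4_sect5 (X : PrintedCarriers) (b9 b11 rOp rBS : Prop)
    (h : (Upstream.ofPrinted X b9 b11 rOp rBS).b4) : B4.Sect5ThmLiteral X.d4 X.N4 :=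
  B4.leafB4_sect5_literal h

/-! ## (v4) The FAITHFUL B8 leaf — Sect. G/H in the typing of `…B8SectGH`

The r1 bundle `B8.Concl` types Proposition 7 with ONE member of the printed hypothesis (1.140) (`C162 1 α₂` =
"L^jη|A| < α₂" only) and Theorem 8 without the printed membership binder "f from the space R(U₀)" — the two
typing objections G-pv17-4 / G-pv17-3 of the cross-read (LEMMAS.md T05.7/T05.8), repaired in the tree by pv17's
sibling module `…B8SectGH` over the carrier extension `GFData3` (all THREE members of (1.140) as `C140`; the
binder as `InR`).  This section binds the DAG leaf `b8` to those FAITHFUL forms WITHOUT touching any v1–v3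
declaration: a carrier extension `PrintedCarriersR` (two predicates and one displayed law per member of the B8
family), the faithful bundle `B8LeafR` (= `B8.Concl` with `p7`/`t8` replaced by `B8SectGH.Prop7PrintedR` /
`B8SectGH.Thm8PrintedAt 1`, the printed "e.g. γ = 1"), the binding `Upstream.ofPrintedR` (every other leaf
literally that of `Upstream.ofPrinted`), and the kernel link OLD ⇒ NEW (`b8LeafR_of_concl`,
`ofPrintedR_b8_of_ofPrinted`: by `B8SectGH.prop7PrintedR_of_printed` / `thm8PrintedAt_one_of_printed` the r1
forms imply the faithful ones — never the converse), so nothing proved downstream of `ofPrinted` is lost.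
Statements of B8 are NOT re-typed here: every conjunct is a by-name reference to `…B8` / `…B8SectGH`. -/

/-- Carrier extension for the faithful B8 leaf: per member `i` of the B8 gauge-fixing family `fam8 i : B8.GFData2`,
the two printed predicates `B8.lean` has no name for — `C140 i α₂ U₀ U₁` = (1.140) p. 100 *"L^jη|A|,
(L^jη)²|∇^η_{U₀}A|, (L^jη)³|D^{η*}_{U₀}D^η_{U₀}A| < α₂ on Ω_j"* (all three members) and `InR i U₀ f` = p. 101
*"f is a function from the space R(U₀)"* — and the displayed law `proj140`: the first member of (1.140) is the
(1.62)-shape bound `C162 1 α₂` ("|A| < 1·α₂(L^jη)^{−1}"), which is how `B8.lean` reads (1.140); it holds by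
unfolding in any honest instance (cf. `B8SectGH.prop7PrintedR_of_printed`, hypothesis `hproj`).
[cite: Balaban1985RegularSpaces, (1.140) p.100 + Thm 8 p.101 + (1.62) p.87] -/
structure PrintedCarriersR extends PrintedCarriers where
  C140 : ∀ i : I8b, ℝ → (fam8 i).Cfg → (fam8 i).Pert → Prop
  InR : ∀ i : I8b, (fam8 i).Cfg → (fam8 i).Src → Prop
  proj140 : ∀ (i : I8b) (α₂ : ℝ) (U₀ : (fam8 i).Cfg) (U₁ : (fam8 i).Pert),
    C140 i α₂ U₀ U₁ → (fam8 i).C162 1 α₂ U₀ U₁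

/-- The B8 family re-packaged over pv17's extended carrier `B8SectGH.GFData3` (the `GFData2` part is literally
`fam8 i`). [folklore] -/
def PrintedCarriersR.fam8R (X : PrintedCarriersR) (i : X.I8b) : B8SectGH.GFData3 :=
  { X.fam8 i with C140 := X.C140 i, InR := X.InR i }

/-- Bookkeeping (kernel-checked): forgetting the two extra predicates gives back `fam8 i`. [folklore] -/
theorem PrintedCarriersR.fam8R_toGFData2 (X : PrintedCarriersR) (i : X.I8b) :
    (X.fam8R i).toGFData2 = X.fam8 i := rfl

/-- The FAITHFUL B8 leaf bundle: `B8.Concl` (Lemma 1 p. 79, Thm 2 p. 83, Prop 3 p. 87, Thm 4 p. 88, Prop 5 p. 94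
both halves, Prop 6 p. 99 — by name, unchanged) with Proposition 7 p. 100 as `B8SectGH.Prop7PrintedR`
(hypothesis (1.139) ∧ (1.140), all three members) and Theorem 8 p. 101 as `B8SectGH.Thm8PrintedAt 1` (membership
binder f ∈ R(U₀); the printed "positive, not too big, constant γ, e.g. γ = 1").  Deliberately absent, as in
`B8.Concl`: (1.147) (printed as unproved, G-B8-09).
[cite: Balaban1985RegularSpaces, Lemma 1 – Thm 8 pp.79–101; Prop. 7 (1.139)–(1.145) p.100; Thm 8 (1.146) p.101] -/
structure B8LeafR {I₁ I₂ I₃ I₄ : Type} (d : ℕ) (L C₂ B₁' B₀' B₁ B₂ c₁ : ℝ) (inp : B8.B9Inputs) (B₀β : ℝ)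
    (loc : I₁ → B8.LocalData) (fam : I₂ → B8SectGH.GFData3) (lan : I₃ → B8.LandauData)
    (cub : I₄ → B8.CubeData) (toAxial : ∀ i, (fam i).Cfg → (fam i).Pert → (fam i).Pert) : Prop where
  l1 : B8.Lemma1Printed d loc
  t2 : B8.Thm2Printed (fun i => (fam i).toGFData)
  p3 : B8.Prop3Printed d L C₂ inp B₀β (fun i => (fam i).toGFData2)
  t4 : B8.Thm4Printed B₁' (fun i => (fam i).toGFData)
  p5e : B8.Prop5Exists B₀' B₁ lan
  p5u : B8.Prop5Unique lan
  p6 : B8.Prop6Printed d L B₁ c₁ cub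
  p7 : B8SectGH.Prop7PrintedR fam toAxial
  t8 : B8SectGH.Thm8PrintedAt 1 B₁ B₂ fam

/-- Bookkeeping (kernel-checked), OLD ⇒ NEW: the r1 bundle `B8.Concl` over `fam8` implies the faithful bundle over
`fam8R` — conjuncts `l1`–`p6` verbatim, `p7` by `B8SectGH.prop7PrintedR_of_printed` with the displayed law
`proj140`, `t8` by `B8SectGH.thm8PrintedAt_one_of_printed`.  The converse is NOT claimed (it is exactly the content
of the typing objections G-pv17-3/4). [folklore] -/
theorem b8LeafR_of_concl (X : PrintedCarriersR)
    (h : B8.Concl X.d8 X.L8 X.C₂ X.B₁' X.B₀' X.B₁ X.B₂ X.c₁ X.inp8 X.B₀β X.loc8 X.fam8 X.lan8 X.cub8 X.toAxial8) :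
    B8LeafR X.d8 X.L8 X.C₂ X.B₁' X.B₀' X.B₁ X.B₂ X.c₁ X.inp8 X.B₀β X.loc8 X.fam8R X.lan8 X.cub8 X.toAxial8 where
  l1 := h.l1
  t2 := h.t2
  p3 := h.p3
  t4 := h.t4
  p5e := h.p5e
  p5u := h.p5u
  p6 := h.p6
  p7 := B8SectGH.prop7PrintedR_of_printed X.fam8R X.toAxial8 X.proj140 h.p7
  t8 := B8SectGH.thm8PrintedAt_one_of_printed X.B₁ X.B₂ X.fam8R h.t8

/-- THE UPSTREAM BINDING WITH THE FAITHFUL B8 LEAF: literally `Upstream.ofPrinted` on the underlying carriers,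
except `b8 := B8LeafR …` over `fam8R`. [folklore] -/
def Upstream.ofPrintedR (X : PrintedCarriersR) (b9 b11 rOperation rBasicStep : Prop) : Upstream :=
  { Upstream.ofPrinted X.toPrintedCarriers b9 b11 rOperation rBasicStep with
    b8 := B8LeafR X.d8 X.L8 X.C₂ X.B₁' X.B₀' X.B₁ X.B₂ X.c₁ X.inp8 X.B₀β X.loc8 X.fam8R X.lan8 X.cub8 X.toAxial8 }

/-- Bookkeeping (kernel-checked): every leaf other than `b8` is that of `Upstream.ofPrinted`. [folklore] -/
theorem ofPrintedR_leaves (X : PrintedCarriersR) (b9 b11 rOp rBS : Prop) :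
    (Upstream.ofPrintedR X b9 b11 rOp rBS).b4 = (Upstream.ofPrinted X.toPrintedCarriers b9 b11 rOp rBS).b4 ∧
    (Upstream.ofPrintedR X b9 b11 rOp rBS).b5 = (Upstream.ofPrinted X.toPrintedCarriers b9 b11 rOp rBS).b5 ∧
    (Upstream.ofPrintedR X b9 b11 rOp rBS).b6 = (Upstream.ofPrinted X.toPrintedCarriers b9 b11 rOp rBS).b6 ∧
    (Upstream.ofPrintedR X b9 b11 rOp rBS).b7 = (Upstream.ofPrinted X.toPrintedCarriers b9 b11 rOp rBS).b7 ∧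
    (Upstream.ofPrintedR X b9 b11 rOp rBS).b9 = (Upstream.ofPrinted X.toPrintedCarriers b9 b11 rOp rBS).b9 ∧
    (Upstream.ofPrintedR X b9 b11 rOp rBS).b10 = (Upstream.ofPrinted X.toPrintedCarriers b9 b11 rOp rBS).b10 ∧
    (Upstream.ofPrintedR X b9 b11 rOp rBS).b11 = (Upstream.ofPrinted X.toPrintedCarriers b9 b11 rOp rBS).b11 ∧
    (Upstream.ofPrintedR X b9 b11 rOp rBS).b12 = (Upstream.ofPrinted X.toPrintedCarriers b9 b11 rOp rBS).b12 ∧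
    (Upstream.ofPrintedR X b9 b11 rOp rBS).b13 = (Upstream.ofPrinted X.toPrintedCarriers b9 b11 rOp rBS).b13 ∧
    (Upstream.ofPrintedR X b9 b11 rOp rBS).rOperation =
      (Upstream.ofPrinted X.toPrintedCarriers b9 b11 rOp rBS).rOperation ∧
    (Upstream.ofPrintedR X b9 b11 rOp rBS).rBasicStep =
      (Upstream.ofPrinted X.toPrintedCarriers b9 b11 rOp rBS).rBasicStep :=
  ⟨rfl, rfl, rfl, rfl, rfl, rfl, rfl, rfl, rfl, rfl, rfl⟩

/-- Bookkeeping (kernel-checked), OLD ⇒ NEW at the leaf: the r1-typed `b8` leaf of `Upstream.ofPrinted` implies the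
faithful `b8` leaf of `Upstream.ofPrintedR`. [folklore] -/
theorem ofPrintedR_b8_of_ofPrinted (X : PrintedCarriersR) (b9 b11 rOp rBS : Prop)
    (h : (Upstream.ofPrinted X.toPrintedCarriers b9 b11 rOp rBS).b8) :
    (Upstream.ofPrintedR X b9 b11 rOp rBS).b8 :=
  b8LeafR_of_concl X h

/-- The faithful `b8` leaf still delivers what `…B8` proves FROM the printed statements by name — e.g. Theorem 8's
printed instance at γ = 1 with the membership binder, for every member of the family. [cite: Balaban1985RegularSpaces, Thm 8 p.101] -/
theorem ofPrintedR_b8_thm8 (X : PrintedCarriersR) (b9 b11 rOp rBS : Prop)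
    (h : (Upstream.ofPrintedR X b9 b11 rOp rBS).b8) : B8SectGH.Thm8PrintedAt 1 X.B₁ X.B₂ X.fam8R :=
  h.t8

/-- As for `ofPrinted`: the bound `b6` leaf of the faithful binding contains B6's "main technical results"
(Prop. 2.6 ∧ Cor. 2.8, p. 249). [cite: Balaban1984PropagatorsII, p.249] -/
theorem ofPrintedR_b6_mainResults (X : PrintedCarriersR) (b9 b11 rOp rBS : Prop)
    (h : (Upstream.ofPrintedR X b9 b11 rOp rBS).b6) : B6.MainResults X.D6 :=
  B6.mainResults_of_statedBlock X.D6 h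

/-! ## (v5) The B9 and B11 leaves — conjunctions of the modules' OWN printed propositions

Up to v4 the leaves `b9` ([Balaban1985BackgroundPropagators] Thms 3.1–3.15) and `b11` ([Balaban1985Variational]
Thm 1, Props 2–9) were `Prop` PARAMETERS of `Upstream.ofPrinted` / `Upstream.ofPrintedR`, because `…B9` and `…B11`
type their results theorem by theorem over several carriers and export no single bundle.  This section supplies the
bundles WITHOUT re-typing anything: two carrier records (`PrintedCarriers9`, `PrintedCarriers11`: exactly the
parameters the module-level `…Printed` propositions take, one field per parameter, shared where the module shares
them — e.g. ONE kernel family `Gp` = G′(U) for Thms 3.1, 3.3, 3.4, Cors 3.5, 3.6 as in `B9.sectsAC_architecture`;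
SEPARATE random-walk expansions for Thm 3.7/Cor 3.8 (G′, (3.90)), Thm 3.9 ((3.98)) and Thm 3.10 (G, (3.107))),
two conjunction bundles `B9Leaf` / `B11Leaf` whose every field is a BY-NAME reference to a proposition of `…B9` /
`…B11` (for B9 Sects. A–C in the separated form that `B9.sectsAC_architecture` concludes: `Cor35Printed`,
`Cor36Printed`, `Thm31Printed`, `Thm32Printed`, `Thm33Printed`, `Thm34Printed`; then Thms 3.7–3.15 with the FULL
Theorem 3.15 `Thm315FullPrinted`, which contains r1's bound-only `Thm315Printed` by `B9.thm315_bound_of_full`),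
and the binding `Upstream.ofPrintedFull` = `Upstream.ofPrintedR` with `b9 := B9Leaf Y`, `b11 := B11Leaf Z`.
Only the two 𝐑 leaves of [Balaban1989LargeFieldI] (`rOperation`, `rBasicStep`: `…B15`, `…B15BasicStep` export no
bundle predicate either) remain parameters.  As everywhere in this module: a leaf is a HYPOTHESIS slot; binding it
asserts nothing about the series. -/

/-- Carriers of the B9 leaf: the parameters of the printed propositions of `…B9` ([Balaban1985BackgroundPropagators]
Thms 3.1–3.15), one field per parameter.  `I9` = the family index (torus, k, {Ω_j}, M) for fixed d, L (p. 399);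
`c35` = the O(1) of the regularity condition (3.35); `Gp`/`GA` = the kernel families G′(U) and its Sect. B companion
(shared by Thms 3.1, 3.3, 3.4, Cors 3.5, 3.6 exactly as in `B9.sectsAC_architecture`); `Cinv` = the kernel of
(Q′G′²Q′*)^{−1} (3.48); `E37` = the expansion (3.90) of G′ (Thm 3.7 and Cor. 3.8, "the term in the expansion
(3.90)"), `EK39` = the kernel expansion (3.98), `E310` = the expansion (3.107) of G; the remaining fields are the
predicate/kernel parameters of Thms 3.11–3.15 under the names `…B9` gives them. [cite: Balaban1985BackgroundPropagators, Thms 3.1–3.15 pp.397–432] -/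
structure PrintedCarriers9 where
  I9 : Type
  d9 : ℕ
  c35 : ℝ
  geo9 : I9 → B9.Geometry
  bg9 : I9 → B9.Backgrounds
  InCube : I9 → Prop
  Gp : ∀ i, B9.KernelFamily (geo9 i) (bg9 i)
  GA : ∀ i, B9.KernelFamily (geo9 i) (bg9 i)
  Cinv : ∀ i, B9.SiteKernel (geo9 i) (bg9 i)
  IsAnalyticExt : ∀ i, B9.KernelFamily (geo9 i) (bg9 i) → (bg9 i).Cfg → ℝ → Prop
  E37 : ∀ i, B9.RWExpansion (geo9 i) (bg9 i)
  EK39 : ∀ i, B9.RWKernelExpansion (geo9 i) (bg9 i)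
  E310 : ∀ i, B9.RWExpansion (geo9 i) (bg9 i)
  PosDef : ∀ i, Fin 5 → (bg9 i).Cfg → Prop
  GD : ∀ i, B9.KernelFamily (geo9 i) (bg9 i)
  G₁ : ∀ i, B9.KernelFamily (geo9 i) (bg9 i)
  H : ∀ i, B9.HKernel (geo9 i) (bg9 i)
  H₁ : ∀ i, B9.HKernel (geo9 i) (bg9 i)
  HasRWExp : ∀ i, B9.KernelFamily (geo9 i) (bg9 i) → (bg9 i).Cfg → ℝ → Prop
  HasRWExpH : ∀ i, B9.HKernel (geo9 i) (bg9 i) → (bg9 i).Cfg → ℝ → Prop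
  PosDefK : ∀ i, B9.KernelFamily (geo9 i) (bg9 i) → (bg9 i).Cfg → Prop
  GG : ∀ i, B9.KernelFamily (geo9 i) (bg9 i)
  Kdiff : ∀ i, B9.KernelFamily (geo9 i) (bg9 i)
  dOmega : ∀ i, (geo9 i).Site → (geo9 i).Site → ℝ
  Ck : ∀ i, B9.SiteKernel (geo9 i) (bg9 i)
  inΛ : ∀ i, (geo9 i).Site → Prop
  unitDist : ∀ i, (geo9 i).Site → (geo9 i).Site → ℝ
  GivenBy3185 : ∀ i, (bg9 i).Cfg → Prop
  HasRWExpC : ∀ i, (bg9 i).Cfg → ℝ → Prop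

/-- **The B9 leaf** as the conjunction of the module's own printed propositions, by name: Sects. A–B in the
separated form concluded by `B9.sectsAC_architecture` (Cor. 3.5, Cor. 3.6, Thm 3.1, Thm 3.2, Thm 3.3, Thm 3.4), the
Sect. C expansions (Thm 3.7, Cor. 3.8, Thm 3.9, Thm 3.10), Sect. D (Thms 3.11, 3.12, 3.13) and Sect. E (Thm 3.14,
the FULL Thm 3.15).  Nothing is re-typed; the GAPS rows attached to each proposition in `…B9` (G-B9-01 … G-B9-19)
travel with the names. [cite: Balaban1985BackgroundPropagators, Thms 3.1–3.15 pp.397–432] -/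
structure B9Leaf (Y : PrintedCarriers9) : Prop where
  c35 : B9.Cor35Printed Y.d9 Y.geo9 Y.bg9 Y.Gp Y.GA Y.Cinv
  c36 : B9.Cor36Printed Y.d9 Y.c35 Y.geo9 Y.bg9 Y.InCube Y.Gp Y.GA Y.Cinv
  t31 : B9.Thm31Printed Y.c35 Y.geo9 Y.bg9 Y.Gp
  t32 : B9.Thm32Printed Y.d9 Y.c35 Y.geo9 Y.bg9 Y.Cinv
  t33 : B9.Thm33Printed Y.c35 Y.geo9 Y.bg9 Y.Gp Y.GA
  t34 : B9.Thm34Printed Y.c35 Y.geo9 Y.bg9 Y.Gp Y.GA Y.IsAnalyticExt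
  t37 : B9.Thm37Printed Y.c35 Y.geo9 Y.bg9 Y.E37
  c38 : B9.Cor38Printed Y.c35 Y.geo9 Y.bg9 Y.E37
  t39 : B9.Thm39Printed Y.d9 Y.c35 Y.geo9 Y.bg9 Y.EK39
  t310 : B9.Thm310Printed Y.c35 Y.geo9 Y.bg9 Y.E310
  t311 : B9.Thm311Printed Y.c35 Y.geo9 Y.bg9 Y.PosDef
  t312 : B9.Thm312Printed Y.d9 Y.c35 Y.geo9 Y.bg9 Y.GD Y.G₁ Y.H Y.H₁ Y.HasRWExp Y.HasRWExpH Y.PosDefK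
  t313 : B9.Thm313Printed Y.c35 Y.geo9 Y.bg9 Y.GG Y.HasRWExp Y.PosDefK
  t314 : B9.Thm314Printed Y.c35 Y.geo9 Y.bg9 Y.Kdiff Y.dOmega
  t315 : B9.Thm315FullPrinted Y.c35 Y.geo9 Y.bg9 Y.Ck Y.inΛ Y.unitDist Y.GivenBy3185 Y.HasRWExpC

/-- Bookkeeping (kernel-checked): the B9 leaf contains r1's bound-only Theorem 3.15 (`B9.Thm315Printed`), by
`B9.thm315_bound_of_full`. [cite: Balaban1985BackgroundPropagators, Thm 3.15 (3.187) p.432] -/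
theorem B9Leaf.t315_bound {Y : PrintedCarriers9} (h : B9Leaf Y) :
    B9.Thm315Printed Y.c35 Y.geo9 Y.bg9 Y.Ck Y.inΛ Y.unitDist :=
  B9.thm315_bound_of_full Y.c35 Y.geo9 Y.bg9 Y.Ck Y.inΛ Y.unitDist Y.GivenBy3185 Y.HasRWExpC h.t315

/-- Bookkeeping (kernel-checked): the Sects. A–B part of the B9 leaf is LITERALLY the conclusion of
`B9.sectsAC_architecture` — so an instance may discharge these six fields from the paper's own leaves (induction base
U = 1, the Sect. B step, the gauge reduction, the Sect. C expansions and summation leaves) by that theorem. [cite: Balaban1985BackgroundPropagators, Sects. A–C pp.397–416] -/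
theorem B9Leaf.sectsAB (Y : PrintedCarriers9) (h : B9Leaf Y) :
    B9.Cor35Printed Y.d9 Y.geo9 Y.bg9 Y.Gp Y.GA Y.Cinv ∧ B9.Cor36Printed Y.d9 Y.c35 Y.geo9 Y.bg9 Y.InCube Y.Gp Y.GA Y.Cinv ∧
    B9.Thm31Printed Y.c35 Y.geo9 Y.bg9 Y.Gp ∧ B9.Thm32Printed Y.d9 Y.c35 Y.geo9 Y.bg9 Y.Cinv ∧
    B9.Thm33Printed Y.c35 Y.geo9 Y.bg9 Y.Gp Y.GA ∧ B9.Thm34Printed Y.c35 Y.geo9 Y.bg9 Y.Gp Y.GA Y.IsAnalyticExt :=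
  ⟨h.c35, h.c36, h.t31, h.t32, h.t33, h.t34⟩

/-- Carriers of the B11 leaf: the parameters of the printed propositions of `…B11` ([Balaban1985Variational] Thm 1,
Props 2–9, Sect. F), one field per parameter — the index type `I11`, the four carrier families of `…B11`
(`VarProblem` for Thm 1, `LGData` for Props 2–6, `VarProblemX` for Props 7–8 and Sect. F, `AnData` for Prop. 9) and
the printed constants under the names `…B11` gives them (B₀, B₁, B₃, B₅, C₁, C₂, C₃, c₁, c₁′ =: `c1h`, c₄, δ₀, β₀),
shared across propositions exactly as the module shares them. [cite: Balaban1985Variational, Thm 1 + Props 2–9 pp.17–51] -/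
structure PrintedCarriers11 where
  I11 : Type
  famV : I11 → B11.VarProblem
  famLG : I11 → B11.LGData
  famX : I11 → B11.VarProblemX
  famAn : I11 → B11.AnData
  B₀ : ℝ
  B₁ : ℝ
  B₃ : ℝ
  B₅ : ℝ
  C₁ : ℝ
  C₂ : ℝ
  C₃ : ℝ
  c₁ : ℝ
  c1h : ℝ
  c₄ : ℝ
  δ₀ : ℝ
  β₀ : ℝ

/-- **The B11 leaf** as the conjunction of the module's own printed propositions, by name: Theorem 1, Propositions
2–8, the Sect. F statement and Proposition 9 of [Balaban1985Variational].  Nothing is re-typed; the GAPS rows of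
`…B11` travel with the names. [cite: Balaban1985Variational, Thm 1 + Props 2–9 pp.17–51] -/
structure B11Leaf (Z : PrintedCarriers11) : Prop where
  t1 : B11.Thm1Printed Z.famV
  p2 : B11.Prop2Printed Z.B₁ Z.B₃ Z.C₁ Z.c₁ Z.famLG
  p3 : B11.Prop3Printed Z.C₁ Z.B₃ Z.C₂ Z.C₃ Z.B₀ Z.c1h Z.c₄ Z.δ₀ Z.famLG
  p4 : B11.Prop4Printed Z.C₁ Z.B₃ Z.famLG
  p5 : B11.Prop5Printed Z.B₁ Z.B₃ Z.C₁ Z.famLG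
  p6 : B11.Prop6Printed Z.B₀ Z.B₃ Z.C₁ Z.famLG
  p7 : B11.Prop7Printed Z.B₃ Z.C₁ Z.famX
  p8 : B11.Prop8Printed Z.B₃ Z.famX
  sF : B11.SectFPrinted Z.B₃ Z.famX
  p9 : B11.Prop9Printed Z.B₅ Z.C₁ Z.β₀ Z.δ₀ Z.famAn

/-- **The binding with every per-paper leaf of [Balaban1983RegularityDecay]–[Balaban1985Variational] a module
bundle**: `Upstream.ofPrintedR` (v4) with `b9 := B9Leaf Y` and `b11 := B11Leaf Z`.  Only the two 𝐑 leaves of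
[Balaban1989LargeFieldI] remain `Prop` parameters. [cite: Balaban1989LargeFieldI, Sect. 1 pp.245–248] -/
def Upstream.ofPrintedFull (X : PrintedCarriersR) (Y : PrintedCarriers9) (Z : PrintedCarriers11)
    (rOperation rBasicStep : Prop) : Upstream :=
  Upstream.ofPrintedR X (B9Leaf Y) (B11Leaf Z) rOperation rBasicStep

/-- Bookkeeping (kernel-checked): the leaves of the full binding, by `rfl` — `b9`, `b11` are the two new bundles and
every other leaf is literally that of `Upstream.ofPrintedR`. [folklore] -/
theorem ofPrintedFull_leaves (X : PrintedCarriersR) (Y : PrintedCarriers9) (Z : PrintedCarriers11)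
    (rOp rBS : Prop) :
    (Upstream.ofPrintedFull X Y Z rOp rBS).b9 = B9Leaf Y ∧
    (Upstream.ofPrintedFull X Y Z rOp rBS).b11 = B11Leaf Z ∧
    (Upstream.ofPrintedFull X Y Z rOp rBS).b8 = (Upstream.ofPrintedR X (B9Leaf Y) (B11Leaf Z) rOp rBS).b8 ∧
    (Upstream.ofPrintedFull X Y Z rOp rBS).rOperation = rOp ∧
    (Upstream.ofPrintedFull X Y Z rOp rBS).rBasicStep = rBS :=
  ⟨rfl, rfl, rfl, rfl, rfl⟩

/-- The bound `b9` leaf delivers the printed theorems of [Balaban1985BackgroundPropagators] by name — e.g. Theorem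
3.3 (the inequalities (3.42)–(3.47) for G′(U)), the form consumed by `…B8FromB9`. [cite: Balaban1985BackgroundPropagators, Thm 3.3 p.399] -/
theorem ofPrintedFull_b9_thm33 (X : PrintedCarriersR) (Y : PrintedCarriers9) (Z : PrintedCarriers11)
    (rOp rBS : Prop) (h : (Upstream.ofPrintedFull X Y Z rOp rBS).b9) :
    B9.Thm33Printed Y.c35 Y.geo9 Y.bg9 Y.Gp Y.GA :=
  h.t33

/-- The bound `b11` leaf delivers the printed Theorem 1 of [Balaban1985Variational] by name. [cite: Balaban1985Variational, Thm 1 p.19] -/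
theorem ofPrintedFull_b11_thm1 (X : PrintedCarriersR) (Y : PrintedCarriers9) (Z : PrintedCarriers11)
    (rOp rBS : Prop) (h : (Upstream.ofPrintedFull X Y Z rOp rBS).b11) : B11.Thm1Printed Z.famV :=
  h.t1

/-- As for `ofPrinted`/`ofPrintedR`: the faithful `b8` leaf and the `b6` main results are untouched by binding
`b9`/`b11`. [cite: Balaban1985RegularSpaces, Thm 8 p.101] -/
theorem ofPrintedFull_b8_thm8 (X : PrintedCarriersR) (Y : PrintedCarriers9) (Z : PrintedCarriers11)
    (rOp rBS : Prop) (h : (Upstream.ofPrintedFull X Y Z rOp rBS).b8) :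
    B8SectGH.Thm8PrintedAt 1 X.B₁ X.B₂ X.fam8R :=
  ofPrintedR_b8_thm8 X (B9Leaf Y) (B11Leaf Z) rOp rBS h

/-! ## (v6) The two 𝐑 leaves — [Balaban1988Convergent] p. 244 and [Balaban1989LargeFieldI] §§0–1, by name

The last two `Prop` parameters of the binding.  `rOperation` is, per `Dag.Leaves`, the property of the large-field
renormalization operation 𝐑 that [Balaban1988Convergent] ASSUMES (p. 244: *"The operation 𝐑 serves this purpose. We
will not describe it here, we will only assume that it has some properties incorporated in the inductive description
of the effective actions."*) — typed by the B14 sub-cell as `B14.RAssumedP244` over the cell's `Setup` densities; it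
is bound to THAT proposition by name (`ROpLeaf`).  `rBasicStep` is, per `Dag.Leaves`, the content of
[Balaban1989LargeFieldI] consumed by [Balaban1989LargeFieldII]: the 𝐑 operation (0.2)–(0.6) with its normalization
(0.4), Proposition 1 p. 194, the bounds (1.80), (1.89), and ℝ′ (1.99)–(1.100) p. 201 with its normalization (1.102)
— typed by the r2/b01 lineages as `B15.Normalization04`, `B15.ExpForm06`, `B15.Prop1Printed`, `B15.Ineq180`,
`B15.BasicStep.Claim189`, `B15.BasicStep.Eq1102`; it is bound to the CONJUNCTION of those propositions by name
(`B15Leaf`), over a carrier record with one field per parameter they take ((1.99)/(1.100) themselves are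
DEFINITIONS — the concrete `B15.BasicStep.normTerm`/`RopReal` — not hypotheses; (1.80) is printed "for p ∈ Ω_k"
and `B15.Ineq180` types one plaquette, so the leaf closes it universally over a plaquette carrier).  With
`Upstream.ofPrintedAll` NO `Prop` parameter remains: every one of the twelve upstream leaves of `Dag.Leaves` is a
module-level printed statement (bundle) referenced by name.  As everywhere in this module a leaf is a HYPOTHESIS
slot: binding it asserts nothing about the series, and in `Dag.B16_main` the leaf `rOperation` is a CONCLUSION slot
(constructed in [Balaban1989LargeFieldI]/[Balaban1989LargeFieldII]) while in `Dag.B14_main` it is a hypothesis. -/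

/-- Carriers of the `rOperation` leaf = the parameters of `B14.RAssumedP244` ([Balaban1988Convergent] p. 244): the
cell's lattice parameters `P`, the gauge group `G` with its `Setup` instances, the number of steps `K`, the operation
`R k` on the densities of the (k+1)-st lattice, and the two families of spaces — `Scorr (k+1)` "the corresponding
assumptions" for a T-image, `S (k+1)` the Sect. 2 assumptions with index k+1 (p. 262). [cite: Balaban1988Convergent, p.244] -/
structure PrintedCarriers14R where
  P : Params
  G : Type
  instGG : GaugeGroup G
  instMS : MeasurableSpace G
  instHD : HaarData G
  K : ℕ
  R : (k : ℕ) → Density P (k + 1) G → Density P (k + 1) G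
  Scorr : (k : ℕ) → Density P k G → Prop
  S : (k : ℕ) → Density P k G → Prop

-- Instances keyed on the projections of THIS carrier record only (the device of `B15.RData.instF`,
-- `PrintedCarriers9`-style bundling): they fire only on goals `GaugeGroup V.G` etc. for a carrier `V` and cannot
-- override or compete with any library instance.
attribute [instance] PrintedCarriers14R.instGG PrintedCarriers14R.instMS PrintedCarriers14R.instHD

/-- **The `rOperation` leaf, by name**: `B14.RAssumedP244` — p. 244 of [Balaban1988Convergent], verbatim there:
*"we will only assume that it has some properties incorporated in the inductive description of the effective
actions"*, typed as `∀ k < K, ∀ ρ′, Scorr (k+1) ρ′ → S (k+1) (R k ρ′)`. [cite: Balaban1988Convergent, p.244] -/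
def ROpLeaf (V : PrintedCarriers14R) : Prop :=
  B14.RAssumedP244 V.R V.Scorr V.S V.K

/-- Unfolding (kernel-checked, `Iff.rfl`): the bound leaf IS the printed p. 244 assumption, instance by instance. [cite: Balaban1988Convergent, p.244] -/
theorem rOpLeaf_iff (V : PrintedCarriers14R) :
    ROpLeaf V ↔ ∀ k, k < V.K → ∀ ρ' : Density V.P (k + 1) V.G, V.Scorr (k + 1) ρ' → V.S (k + 1) (V.R k ρ') :=
  Iff.rfl

/-- The bound `rOperation` leaf is exactly the form the B14 module's kernel-checked p. 262 remark consumes: with the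
p. 245 Theorem (space reading) for the T of a density-RG datum whose 𝐑 is the carrier's `R`, *"the operation 𝐑T
transforms the space with the index k into the space with the index k+1"* (`B14.mapsSpaces_of_thmP245Spaces`). [cite: Balaban1988Convergent, Theorem p.245 with remark p.262] -/
theorem ROpLeaf.mapsSpaces (V : PrintedCarriers14R) {av : ∀ j, Averaging V.P j V.G}
    (D : Step.DensityRG V.P V.G av) (hR : ∀ k ρ, D.R k ρ = V.R k ρ)
    (hT : B14.ThmP245Spaces D.T V.S V.Scorr V.K) (h : ROpLeaf V) : D.MapsSpaces V.S V.K :=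
  B14.mapsSpaces_of_thmP245Spaces D hT (by
    intro k hk ρ' hρ
    rw [hR]
    exact h k hk ρ' hρ)

/-- Carriers of the `rBasicStep` leaf = the parameters of the printed propositions of `…B15` / `…B15.BasicStep`
([Balaban1989LargeFieldI]), one field per parameter: the abstract integration datum `D` of (0.2)–(0.6) with the
index type `Zpp` of regions Z″, pieces `ρpp` and exponent sums `Rsum` of (0.6); the Proposition 1 carrier `LF`;
for (1.80) the plaquettes `Plaq` of Ω_k with their deviations `dev180 p = |U₀(∂p) − 1|` and distances
`distΛ p = dist(p, Λ)` and the printed reals ε_k, η, B₃, B₅, M, δ and the O(1) `C180`; for (1.89) the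
configurations `Cfg` with the two conjunctions of characteristic-function restrictions `remaining`/`dropped`;
for (1.102) the concrete `Setup` data of ONE lattice — parameters `P15`, step `j15`, gauge group `G15` with its
instances, the operator `Rprime` = ℝ′ on its densities and the density `ρk` it is applied to. [cite: Balaban1989LargeFieldI, (0.2)–(0.6) p.176] -/
structure PrintedCarriers15 where
  D : B15.RData
  Zpp : Type
  instZ : Fintype Zpp
  ρpp : Zpp → D.Vsp → ℝ
  Rsum : Zpp → D.Vsp → ℝ
  LF : B15.LFVar
  Plaq : Type
  dev180 : Plaq → ℝ
  distΛ : Plaq → ℝ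
  εk : ℝ
  η : ℝ
  B₃ : ℝ
  B₅ : ℝ
  M : ℝ
  δ : ℝ
  C180 : ℝ
  Cfg : Type
  remaining : Cfg → Prop
  dropped : Cfg → Prop
  P15 : Params
  j15 : ℕ
  G15 : Type
  instGG15 : GaugeGroup G15
  instMS15 : MeasurableSpace G15
  instHD15 : HaarData G15
  Rprime : Density P15 j15 G15 → Density P15 j15 G15
  ρk : Density P15 j15 G15

-- As above: instances keyed on the projections of this carrier record only (cf. `B15.RData.instF`).
attribute [instance] PrintedCarriers15.instZ PrintedCarriers15.instGG15 PrintedCarriers15.instMS15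
  PrintedCarriers15.instHD15

/-- **The `rBasicStep` leaf, by name** — the conjunction of the printed statements of [Balaban1989LargeFieldI] that
`Dag.Leaves.rBasicStep` lists, each a reference to the proposition of `…B15` / `…B15.BasicStep` typing it:
(0.4) `Normalization04`, (0.5)–(0.6) `ExpForm06`, Proposition 1 (1.78) `Prop1Printed`, (1.80) `Ineq180` for every
plaquette of Ω_k, (1.89) `Claim189`, (1.102) `Eq1102` (the normalization of ℝ′ (1.99)–(1.100) p. 201).  Hypothesis
slot only. [cite: Balaban1989LargeFieldI, Prop. 1 (1.78) p.194] -/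
structure B15Leaf (W : PrintedCarriers15) : Prop where
  n04 : B15.Normalization04 W.D
  e06 : B15.ExpForm06 W.D W.Zpp W.ρpp W.Rsum
  p1 : B15.Prop1Printed W.LF
  i180 : ∀ p : W.Plaq, B15.Ineq180 (W.dev180 p) W.εk W.η W.B₃ W.B₅ W.M W.δ (W.distΛ p) W.C180
  c189 : B15.BasicStep.Claim189 W.remaining W.dropped
  e1102 : B15.BasicStep.Eq1102 W.Rprime W.ρk

/-- The bound leaf delivers Proposition 1 of [Balaban1989LargeFieldI] in its printed quantifier order (B₅ first,
instance-independent): unfolded by name. [cite: Balaban1989LargeFieldI, Prop. 1 (1.78) p.194] -/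
theorem B15Leaf.prop1_unfold {W : PrintedCarriers15} (h : B15Leaf W) :
    ∃ B₅ : ℝ, 0 < B₅ ∧ ∀ i : W.LF.Inst, ∃ e0 : ℝ, 0 < e0 ∧ ∀ ε : ℝ, 0 < ε → ε ≤ e0 →
      ∀ X : W.LF.Bdry i, W.LF.Regular i ε X →
        ∃ O : W.LF.Orbit i, W.LF.IsCritical i X O ∧ (∀ O' : W.LF.Orbit i, W.LF.IsCritical i X O' → O' = O) ∧
          W.LF.IsMinimum i X O ∧ W.LF.dev i O < B₅ * (W.LF.M i) ^ 5 * ε ∧ W.LF.AnalyticExt i ε X :=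
  h.p1

/-- The (1.89) member of the bound leaf in the printed equality form `χ_new · χ_old = χ_new` of {0,1}-valued
functions (`B15.BasicStep.claim129_iff_indicator`). [cite: Balaban1989LargeFieldI, (1.89) p.198] -/
theorem B15Leaf.c189_indicator {W : PrintedCarriers15} (h : B15Leaf W)
    [DecidablePred W.remaining] [DecidablePred W.dropped] :
    ∀ U, (if W.remaining U then (1:ℝ) else 0) * (if W.dropped U then 1 else 0) =
      if W.remaining U then 1 else 0 :=
  (B15.BasicStep.claim129_iff_indicator W.remaining W.dropped).1 h.c189

/-- **The binding with NO `Prop` parameter left**: `Upstream.ofPrintedFull` (v5) with `rOperation := ROpLeaf V`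
and `rBasicStep := B15Leaf W`.  Every upstream leaf of `Dag.Leaves` — `b4` … `b13`, `rOperation`, `rBasicStep` —
is now a module-level printed statement of the cell referenced by name. [cite: Balaban1989LargeFieldI, (0.2)–(0.6) p.176] -/
def Upstream.ofPrintedAll (X : PrintedCarriersR) (Y : PrintedCarriers9) (Z : PrintedCarriers11)
    (V : PrintedCarriers14R) (W : PrintedCarriers15) : Upstream :=
  Upstream.ofPrintedFull X Y Z (ROpLeaf V) (B15Leaf W)

/-- Bookkeeping (kernel-checked, by `rfl`): the leaves of the parameter-free binding. [folklore] -/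
theorem ofPrintedAll_leaves (X : PrintedCarriersR) (Y : PrintedCarriers9) (Z : PrintedCarriers11)
    (V : PrintedCarriers14R) (W : PrintedCarriers15) :
    (Upstream.ofPrintedAll X Y Z V W).rOperation = ROpLeaf V ∧
    (Upstream.ofPrintedAll X Y Z V W).rBasicStep = B15Leaf W ∧
    (Upstream.ofPrintedAll X Y Z V W).b9 = B9Leaf Y ∧
    (Upstream.ofPrintedAll X Y Z V W).b11 = B11Leaf Z ∧
    (Upstream.ofPrintedAll X Y Z V W).b8 = (Upstream.ofPrintedFull X Y Z (ROpLeaf V) (B15Leaf W)).b8 ∧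
    (Upstream.ofPrintedAll X Y Z V W).b4 = (Upstream.ofPrintedFull X Y Z (ROpLeaf V) (B15Leaf W)).b4 :=
  ⟨rfl, rfl, rfl, rfl, rfl, rfl⟩

/-- The bound `rOperation` leaf, applied: one step of the assumed 𝐑 (p. 244). [cite: Balaban1988Convergent, p.244] -/
theorem ofPrintedAll_rOperation_apply (X : PrintedCarriersR) (Y : PrintedCarriers9) (Z : PrintedCarriers11)
    (V : PrintedCarriers14R) (W : PrintedCarriers15) (h : (Upstream.ofPrintedAll X Y Z V W).rOperation)
    {k : ℕ} (hk : k < V.K) (ρ' : Density V.P (k + 1) V.G) (hρ : V.Scorr (k + 1) ρ') :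
    V.S (k + 1) (V.R k ρ') :=
  h k hk ρ' hρ

/-- The bound `rBasicStep` leaf delivers Proposition 1 of [Balaban1989LargeFieldI] by name. [cite: Balaban1989LargeFieldI, Prop. 1 (1.78) p.194] -/
theorem ofPrintedAll_rBasicStep_prop1 (X : PrintedCarriersR) (Y : PrintedCarriers9) (Z : PrintedCarriers11)
    (V : PrintedCarriers14R) (W : PrintedCarriers15) (h : (Upstream.ofPrintedAll X Y Z V W).rBasicStep) :
    B15.Prop1Printed W.LF :=
  h.p1

/-- As for every earlier binding: the faithful `b8` leaf, the `b9`/`b11` bundles and the `b6` main results are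
untouched by binding the 𝐑 leaves. [cite: Balaban1985RegularSpaces, Thm 8 p.101] -/
theorem ofPrintedAll_b8_thm8 (X : PrintedCarriersR) (Y : PrintedCarriers9) (Z : PrintedCarriers11)
    (V : PrintedCarriers14R) (W : PrintedCarriers15) (h : (Upstream.ofPrintedAll X Y Z V W).b8) :
    B8SectGH.Thm8PrintedAt 1 X.B₁ X.B₂ X.fam8R :=
  ofPrintedFull_b8_thm8 X Y Z (ROpLeaf V) (B15Leaf W) h

/-- … and Theorem 3.3 of [Balaban1985BackgroundPropagators] from the `b9` bundle, unchanged. [cite: Balaban1985BackgroundPropagators, Thm 3.3 p.399] -/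
theorem ofPrintedAll_b9_thm33 (X : PrintedCarriersR) (Y : PrintedCarriers9) (Z : PrintedCarriers11)
    (V : PrintedCarriers14R) (W : PrintedCarriers15) (h : (Upstream.ofPrintedAll X Y Z V W).b9) :
    B9.Thm33Printed Y.c35 Y.geo9 Y.bg9 Y.Gp Y.GA :=
  h.t33



/-! ## (v7) The B9 leaf EXTENDED by the printed displayed claims (3.49), (3.132) and the local Thm 3.14 reading — [Balaban1985BackgroundPropagators]

Answer to the reader remarks G-pv18-4 / G-pv18-5 on §(v5) (pub-balaban GAPS.md): `B9Leaf` is by rule the conjunction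
of the fifteen NUMBERED statements of [Balaban1985BackgroundPropagators] Sect. 3; two printed DISPLAYED CLAIMS of the
same paper that the downstream papers cite as results of it lie outside that rule — (3.49) p. 399 (bounds for the
kernel `P` of `R = I − P`, *"These theorems imply all the properties of the operator R …"*; consumed by
[Balaban1985RegularSpaces] (1.101) p. 93) and (3.132) p. 422 (the bound for `(QGQ*)⁻¹`, *"Let us write only bounds"*,
*"and the same for the operator with G₁"*; consumed by [Balaban1985Variational] (129)–(130) pp. 297–298) —
and Theorem 3.14 pp. 426–427 (*"then their difference satisfies all the inequalities characteristic for operators of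
the considered type, with the additional factor exp(−δ₀d(y, y′, Ω))"*) has, besides the sup-entries reading
`B9.Thm314Printed` bound in `B9Leaf.t314`, the fuller LOCAL reading `B9Thm314.Thm314LocalPrinted` (sup + L² + Hölder
entries, for y, y′ ∈ Ω^{(k)}).  Since `Dag.B8_main` and `Dag.B11_main` route those citations through `b9`, v7 offers
the EXTENDED leaf `B9LeafX` = `B9Leaf` ∧ (3.49) ∧ (3.132) ∧ Thm 3.14 (local), over `PrintedCarriers9X extends
PrintedCarriers9` (four more carriers), and `Upstream.ofPrintedAllX`.  ADDITIVE: nothing of v1–v6 is re-typed;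
`B9LeafX Y → B9Leaf Y.toPrintedCarriers9` (`B9LeafX.numbered`), so every v6 consumer is served by the X-leaf.  As
everywhere here the leaf is a HYPOTHESIS slot — (3.49) and (3.132) are unproved-in-print located claims (G-B9-12,
G-B9-15) and binding them asserts nothing. -/

/-- Carriers of the extended B9 leaf: those of `PrintedCarriers9` plus the fine-lattice kernel `P` of (3.49) p. 399,
the site kernels `(QGQ*)⁻¹`, `(QG₁Q*)⁻¹` of (3.132) p. 422, and the localisation predicate `Ω^{(k)}` of the local
reading of Theorem 3.14 pp. 426–427. [cite: Balaban1985BackgroundPropagators, (3.49) p.399] -/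
structure PrintedCarriers9X extends PrintedCarriers9 where
  P349 : ∀ i, B9.FineKernel (geo9 i) (bg9 i)
  QGQinv : ∀ i, B9.SiteKernel (geo9 i) (bg9 i)
  QG1Qinv : ∀ i, B9.SiteKernel (geo9 i) (bg9 i)
  OmK : ∀ i, (geo9 i).Site → Prop

/-- **The extended B9 leaf, by name**: the v5 leaf `B9Leaf` (fifteen numbered statements) AND the printed displayed
claims (3.49) `B9.Stmt349Printed`, (3.132) `B9.Stmt3132Printed`, AND the local reading of Theorem 3.14
`B9Thm314.Thm314LocalPrinted` — each field a reference to the proposition of `…B9` / `…B9Thm314` typing it.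
Hypothesis slot only. [cite: Balaban1985BackgroundPropagators, (3.132) p.422] -/
structure B9LeafX (Y : PrintedCarriers9X) : Prop where
  numbered : B9Leaf Y.toPrintedCarriers9
  s349 : B9.Stmt349Printed Y.d9 Y.c35 Y.geo9 Y.bg9 Y.P349
  s3132 : B9.Stmt3132Printed Y.d9 Y.c35 Y.geo9 Y.bg9 Y.QGQinv Y.QG1Qinv
  t314loc : B9Thm314.Thm314LocalPrinted Y.c35 Y.geo9 Y.bg9 Y.Kdiff Y.OmK Y.dOmega

/-- The extended leaf projects to the v5 leaf (monotonicity of the extension). [cite: Balaban1985BackgroundPropagators, Thm 3.3 p.398] -/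
theorem B9LeafX.toLeaf {Y : PrintedCarriers9X} (h : B9LeafX Y) : B9Leaf Y.toPrintedCarriers9 :=
  h.numbered

/-- Theorem 3.3 from the extended leaf (what `Dag.B8_main` consumes), by name. [cite: Balaban1985BackgroundPropagators, Thm 3.3 p.398] -/
theorem B9LeafX.t33 {Y : PrintedCarriers9X} (h : B9LeafX Y) :
    B9.Thm33Printed Y.c35 Y.geo9 Y.bg9 Y.Gp Y.GA :=
  h.numbered.t33

/-- The local Theorem 3.14 reading of the extended leaf contains the sup-entry reading on Ω^{(k)}
(`B9Thm314.supOn_of_local`). [cite: Balaban1985BackgroundPropagators, Thm 3.14 pp.426–427] -/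
theorem B9LeafX.t314_supOn {Y : PrintedCarriers9X} (h : B9LeafX Y) :
    B9Thm314.Thm314SupOn Y.c35 Y.geo9 Y.bg9 Y.Kdiff Y.OmK Y.dOmega :=
  B9Thm314.supOn_of_local h.t314loc

/-- **The binding with the extended B9 leaf** (no `Prop` parameter): `Upstream.ofPrintedR` with `b9 := B9LeafX Y`,
`b11 := B11Leaf Z`, `rOperation := ROpLeaf V`, `rBasicStep := B15Leaf W`. [cite: Balaban1985BackgroundPropagators, (3.49) p.399] -/
def Upstream.ofPrintedAllX (X : PrintedCarriersR) (Y : PrintedCarriers9X) (Z : PrintedCarriers11)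
    (V : PrintedCarriers14R) (W : PrintedCarriers15) : Upstream :=
  Upstream.ofPrintedR X (B9LeafX Y) (B11Leaf Z) (ROpLeaf V) (B15Leaf W)

/-- Bookkeeping: the leaves of the X-binding, definitionally; `b8`, `b4` (and all other per-paper leaves) agree with
the v6 binding over the underlying carriers. [cite: Balaban1985BackgroundPropagators, Thm 3.3 p.398] -/
theorem ofPrintedAllX_leaves (X : PrintedCarriersR) (Y : PrintedCarriers9X) (Z : PrintedCarriers11)
    (V : PrintedCarriers14R) (W : PrintedCarriers15) :
    (Upstream.ofPrintedAllX X Y Z V W).b9 = B9LeafX Y ∧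
    (Upstream.ofPrintedAllX X Y Z V W).b11 = B11Leaf Z ∧
    (Upstream.ofPrintedAllX X Y Z V W).rOperation = ROpLeaf V ∧
    (Upstream.ofPrintedAllX X Y Z V W).rBasicStep = B15Leaf W ∧
    (Upstream.ofPrintedAllX X Y Z V W).b8 = (Upstream.ofPrintedAll X Y.toPrintedCarriers9 Z V W).b8 ∧
    (Upstream.ofPrintedAllX X Y Z V W).b4 = (Upstream.ofPrintedAll X Y.toPrintedCarriers9 Z V W).b4 :=
  ⟨rfl, rfl, rfl, rfl, rfl, rfl⟩

/-- The X-binding's `b9` leaf implies the v6 binding's `b9` leaf over the underlying carriers (the extension only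
adds conjuncts). [cite: Balaban1985BackgroundPropagators, Thm 3.3 p.398] -/
theorem ofPrintedAllX_b9_toAll (X : PrintedCarriersR) (Y : PrintedCarriers9X) (Z : PrintedCarriers11)
    (V : PrintedCarriers14R) (W : PrintedCarriers15) (h : (Upstream.ofPrintedAllX X Y Z V W).b9) :
    (Upstream.ofPrintedAll X Y.toPrintedCarriers9 Z V W).b9 :=
  h.numbered

/-- (3.49) from the X-binding's `b9` leaf — the displayed claim [Balaban1985RegularSpaces] (1.101) p. 93 cites ("R = I − P").
[cite: Balaban1985BackgroundPropagators, (3.49) p.399] -/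
theorem ofPrintedAllX_b9_s349 (X : PrintedCarriersR) (Y : PrintedCarriers9X) (Z : PrintedCarriers11)
    (V : PrintedCarriers14R) (W : PrintedCarriers15) (h : (Upstream.ofPrintedAllX X Y Z V W).b9) :
    B9.Stmt349Printed Y.d9 Y.c35 Y.geo9 Y.bg9 Y.P349 :=
  h.s349

/-- (3.132) from the X-binding's `b9` leaf — the displayed claim [Balaban1985Variational] (129)–(130) pp. 297–298 rest on.
[cite: Balaban1985BackgroundPropagators, (3.132) p.422] -/
theorem ofPrintedAllX_b9_s3132 (X : PrintedCarriersR) (Y : PrintedCarriers9X) (Z : PrintedCarriers11)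
    (V : PrintedCarriers14R) (W : PrintedCarriers15) (h : (Upstream.ofPrintedAllX X Y Z V W).b9) :
    B9.Stmt3132Printed Y.d9 Y.c35 Y.geo9 Y.bg9 Y.QGQinv Y.QG1Qinv :=
  h.s3132

/-! ## (v8) The END side on the PINNED printed form of (B) — `B16.EndStatementBPrinted` (B16 v5; cell GAPS G-pv24-1, ruling C-r2.23)

The `World` binding above fixes the (0.1) exponent constants `Em, Ep` BEFORE the run, so the DAG's (B) over all runs of a
world is the run-uniform reading `B16.EndStatementB = Thm1Printed ∧ UVBound01` (`endStatementB_of_worlds` /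
`worlds_of_endStatementB`).  Revision v5 of `…B16` PINS (B) in its printed CONDITIONAL form
`B16.EndStatementBPrinted = Thm1Printed ∧ Cor3_250` ([Balaban1989LargeFieldII] p. 391: *"This completes the proof of Theorem 1
and Corollary 3."*; [Balaban1988Convergent] Cor. 3 (2.50) p. 264: *"constants E_−, E_+ independent of η and T, but depending
on g_k"*), records `EndStatementB → EndStatementBPrinted` (`B16.endStatementBPrinted_of_endStatementB`), and records that
the converse needs dependence functions bounded on ]0, γ] — a hypothesis the sibling `…B16B10Shape` shows NOT dischargeable
UNDER TWO READER'S HYPOTHESES (`not_uvBound01_of_smallCouplings`: `LogNormalised` = the step-0 logarithm `UnitConfigLog`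
with constants uniform over the ]0, γ]-family — pv24's reading of [Balaban1988Convergent] Thm 1 p. 262 and (1.15), typed as a
HYPOTHESIS, its leaves being reader's items (cell GAPS G-pv24-1 (i)–(iii), OPEN; REFEREE R19 / G-ref2-11 (a): not a fact
about the printed normalisation) — together with `SmallCouplingsOccur` (arbitrarily small bare couplings in the family) give
`¬ B16.UVBound01`, hence `¬ B16.EndStatementB`; v10.2a POINTER: on forward-generated constructions with non-empty lattices
and sub-unit zero-step densities that PAIR is vacuous — `SmallCouplingsOccur` holds by the zero-step runs and `LogNormalised`
fails at them, `B16SmallCouplings.smallCouplingsOccur_of_forwardGenerated` / `…logNormalised_family_unsatisfiable` —, and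
the non-vacuous K-indexed form is `B16SmallCouplings.not_uvBound01_of_betaUpper`: see the note in the docstring of
`not_forall_uvStability4D_leaves_of_smallCouplings` below).  CONSEQUENCE FOR THIS MODULE (honesty note): for constructions satisfying
those two hypotheses the hypotheses of `endStatementB_of_nodes` / `…_interval` / `sect2Unconditional_of_nodes` are JOINTLY
UNSATISFIABLE (node N13
`Dag.B16_main` at constant-exponent leaves for every run would give `UVBound01`); those theorems stay (importers use them)
and are correct implications, but the faithful END headline is the one below.  This section (append-only; no earlier
declaration touched) binds the `uvBounds` leaf with the exponents as DEPENDENCE FUNCTIONS `em, ep : ℝ → ℝ` of the running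
coupling `g_k` — the [III] Cor. 3 reading — and proves that the DAG's (B) over all runs of such a world IS the pin, in both
directions, with the same flow-side discharges as before.  Bookkeeping only; nothing of the series is asserted. -/

/-- A binding context whose (0.1)/(2.50) exponents are DEPENDENCE FUNCTIONS `em, ep : ℝ → ℝ` of the running coupling
([Balaban1988Convergent] Cor. 3 (2.50) p. 264: *"independent of η and T, but depending on g_k"*); all other fields as in
`World`.  A binding context (dictionary), not a printed display. [folklore] -/
structure WorldP where
  C : B16.Construction
  γ : ℝ
  em : ℝ → ℝ
  ep : ℝ → ℝ
  βup : ℝ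
  β₀ : ℝ
  β₀_pos : 0 < β₀
  b : ℝ
  b_pos : 0 < b
  L : ℝ
  one_lt_L : 1 < L
  gR : ℝ
  up : B12.RunParams → Upstream

/-- Forgetting the dependence: the constant-exponent `World` on the same data with given `Em, Ep` (used only to transport
the FLOW-side discharges, which never look at the `uvBounds` leaf). [folklore] -/
def WorldP.withConsts (w : WorldP) (Em Ep : ℝ) : World :=
  ⟨w.C, w.γ, Em, Ep, w.βup, w.β₀, w.β₀_pos, w.b, w.b_pos, w.L, w.one_lt_L, w.gR, w.up⟩

/-- A constant-exponent world read as a dependence-function world (constant functions). [folklore] -/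
def World.toWorldP (w : World) : WorldP :=
  ⟨w.C, w.γ, fun _ => w.Em, fun _ => w.Ep, w.βup, w.β₀, w.β₀_pos, w.b, w.b_pos, w.L, w.one_lt_L, w.gR, w.up⟩

/-- THE BINDING WITH COUPLING-DEPENDENT EXPONENTS: the 22 leaves for the world `w` and the run `P` — identical to `leaves`
field by field EXCEPT `uvBounds := ∀ k ≤ K, ∀ V, B16.UVIneq (w.C P) k V (em (g_k)) (ep (g_k))` ((2.50) of [III] for the
run, [Balaban1988Convergent] Cor. 3 p. 264).  A binding context (dictionary of the typed leaves), not a printed display;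
the printed statements are the `B*` Props it names, each tagged in its own module. [folklore] -/
def leavesP (w : WorldP) (P : B12.RunParams) : Dag.Leaves where
  b4 := (w.up P).b4
  b5 := (w.up P).b5
  b6 := (w.up P).b6
  b7 := (w.up P).b7
  b8 := (w.up P).b8
  b9 := (w.up P).b9
  b10 := (w.up P).b10
  b11 := (w.up P).b11
  b12 := (w.up P).b12
  b13 := (w.up P).b13
  smallFieldInductive := ∀ k, k ≤ P.K → (w.C P).IndAss k
  rOperation := (w.up P).rOperation
  rBasicStep := (w.up P).rBasicStep
  densitiesDescribed := ∀ k, k ≤ P.K → (w.C P).Sect2Form k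
  uvBounds := ∀ k, k ≤ P.K → ∀ V : (w.C P).Cfg k,
    B16.UVIneq (w.C P) k V (w.em ((w.C P).flow.g k)) (w.ep ((w.C P).flow.g k))
  smallCouplings := (w.C P).flow.InInterval w.γ P.K
  thm2Regime := Thm2RegimeOf (w.C P).flow P.K w.γ w.gR
  running := B14.H033LogRunning w.L w.gR (w.b / Real.log w.L) (w.βup / Real.log w.L) (w.C P).flow P.K
  rgFlow := (w.C P).flow.SatisfiesRG P.K
  betaSmoothBounded := ∀ j, j < P.K → (w.C P).flow.β (j + 1) ((w.C P).flow.g j) ≤ w.βup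
  betaPositive := ∀ j, j < P.K → w.b ≤ (w.C P).flow.β (j + 1) ((w.C P).flow.g j)
  flowControl := B14.FlowIneq26 (w.C P).flow.g w.βup w.β₀ P.K

/-- The constant-exponent binding is the special case of constant dependence functions (kernel-checked, `rfl`). [folklore] -/
theorem leavesP_toWorldP (w : World) (P : B12.RunParams) : leavesP w.toWorldP P = leaves w P := rfl

/-- `Dag.FlowStepOfBeta` HOLDS at the `leavesP` binding ((2.6) from (0.20) + `0 ≤ β ≤ β⁺` + positive couplings, as in
`flowStepOfBeta_leaves`). [cite: Balaban1988Convergent, (2.6) p.255] -/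
theorem flowStepOfBeta_leavesP (w : WorldP) (P : B12.RunParams) : Dag.FlowStepOfBeta (leavesP w P) :=
  fun hrg hsb hpos hsc => flowIneq26_of_alongRun (w.withConsts 0 0) P hrg hsb hpos fun k hk => (hsc k hk).1

/-- `Dag.FlowStepPrinted` at the `leavesP` binding from the three β/RG leaves. [folklore] -/
theorem flowStepPrinted_leavesP (w : WorldP) (P : B12.RunParams)
    (hrg : (leavesP w P).rgFlow) (hsb : (leavesP w P).betaSmoothBounded) (hpos : (leavesP w P).betaPositive) :
    Dag.FlowStepPrinted (leavesP w P) :=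
  Dag.flowStepPrinted_of_beta (leavesP w P) (flowStepOfBeta_leavesP w P) hrg hsb hpos

/-- `Dag.Thm2OfBeta` HOLDS at the `leavesP` binding (telescoping, as in `thm2OfBeta_leaves`). [cite: Balaban1987RG1, Thm 2 (0.31) p.259] -/
theorem thm2OfBeta_leavesP (w : WorldP) (P : B12.RunParams) : Dag.Thm2OfBeta (leavesP w P) := by
  intro hrg hsb hpos hreg
  obtain ⟨hg, hgγ, hK, hposg⟩ := hreg
  have hd : Step.Discrete031 w.b w.βup P.K ((w.C P).flow.g P.K) (w.C P).flow.g :=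
    discrete031_along ((Step.rgEq_iff _ _).1 hrg) hpos hsb
  rw [hK] at hd
  refine ⟨?_, ?_⟩
  · exact (Step.inInterval_iff _ _ _).2 (Step.inInterval_of_discrete031 (le_of_lt w.b_pos) hg hgγ hposg hd)
  · intro k hk
    exact ((h033LogRunning_iff_discrete031 w.L w.gR w.b w.βup w.one_lt_L (w.C P).flow P.K).2 hd) k hk

/-- Unfolding: the DAG's end statement at the `leavesP` binding, verbatim — (2.50) of [III] for the run under the interval
hypothesis, together with the §2 description. [folklore] -/
theorem uvStability4D_leavesP_iff (w : WorldP) (P : B12.RunParams) :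
    Dag.UVStability4D (leavesP w P) ↔
      ((w.C P).flow.InInterval w.γ P.K →
        (∀ k, k ≤ P.K → (w.C P).Sect2Form k) ∧
          ∀ k, k ≤ P.K → ∀ V : (w.C P).Cfg k,
            B16.UVIneq (w.C P) k V (w.em ((w.C P).flow.g k)) (w.ep ((w.C P).flow.g k))) :=
  Iff.rfl

/-- **(B) over all runs of a dependence-function world ⇒ THE PIN** `B16.EndStatementBPrinted w.C` = [Balaban1989LargeFieldII]
Thm 1 ∧ [Balaban1988Convergent] Cor. 3 (2.50), with this world's `γ` and `em, ep` as the witnesses. [cite: Balaban1989LargeFieldII, Thm 1 p.355 + p.391] -/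
theorem endStatementBPrinted_of_worldsP (w : WorldP) (hγ : 0 < w.γ) (h : ∀ P, Dag.UVStability4D (leavesP w P)) :
    B16.EndStatementBPrinted w.C :=
  ⟨⟨w.γ, hγ, fun P hP k hk => ((uvStability4D_leavesP_iff w P).1 (h P) hP).1 k hk⟩,
    ⟨w.γ, hγ, w.em, w.ep, fun P hP k hk V => ((uvStability4D_leavesP_iff w P).1 (h P) hP).2 k hk V⟩⟩

/-- **Conversely**, the pin `B16.EndStatementBPrinted C` yields a dependence-function world on `C` (`γ = min γ₁ γ₂` of
its two existential constants, the Cor. 3 witnesses `em, ep`; remaining data arbitrary) in which (B) holds for every run —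
so the `leavesP` binding loses nothing on the END side and adds nothing: the DAG's (B) over all runs IS the pin.
Uses only that `Flow.InInterval` is antitone in `γ`. [folklore] -/
theorem worldsP_of_endStatementBPrinted (C : B16.Construction) (h : B16.EndStatementBPrinted C)
    (βup β₀ : ℝ) (hβ₀ : 0 < β₀) (b : ℝ) (hb : 0 < b) (L : ℝ) (hL : 1 < L) (gR : ℝ)
    (up : B12.RunParams → Upstream) :
    ∃ (γ : ℝ) (em ep : ℝ → ℝ), 0 < γ ∧
      ∀ P, Dag.UVStability4D (leavesP ⟨C, γ, em, ep, βup, β₀, hβ₀, b, hb, L, hL, gR, up⟩ P) := by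
  obtain ⟨⟨γ₁, hγ₁, H1⟩, ⟨γ₂, hγ₂, em, ep, H2⟩⟩ := h
  refine ⟨min γ₁ γ₂, em, ep, lt_min hγ₁ hγ₂, fun P => ?_⟩
  rw [uvStability4D_leavesP_iff]
  intro hP
  have h1 : (C P).flow.InInterval γ₁ P.K := fun k hk => ⟨(hP k hk).1, le_trans (hP k hk).2 (min_le_left _ _)⟩
  have h2 : (C P).flow.InInterval γ₂ P.K := fun k hk => ⟨(hP k hk).1, le_trans (hP k hk).2 (min_le_right _ _)⟩
  exact ⟨fun k hk => H1 P h1 k hk, fun k hk V => H2 P h2 k hk V⟩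

/-- HEADLINE (v8, END side on the pin).  For a dependence-function world with `γ > 0`: if for every run the thirteen paper
nodes hold at the `leavesP` binding, the couplings satisfy (0.20), and `b ≤ β_{j+1}(g_j) ≤ β⁺` along every run, then the
PINNED end statement `B16.EndStatementBPrinted w.C` holds.  Every located input is a named hypothesis. [cite: Balaban1989LargeFieldII, Thm 1 p.355 + p.391] -/
theorem endStatementBPrinted_of_nodesP (w : WorldP) (hγ : 0 < w.γ) (hnodes : ∀ P, Nodes (leavesP w P))
    (hrg : ∀ P, (leavesP w P).rgFlow) (hsb : ∀ P, (leavesP w P).betaSmoothBounded)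
    (hpos : ∀ P, (leavesP w P).betaPositive) : B16.EndStatementBPrinted w.C :=
  endStatementBPrinted_of_worldsP w hγ fun P =>
    uvStability_of_nodes (leavesP w P) (hnodes P) (flowStepPrinted_leavesP w P (hrg P) (hsb P) (hpos P))

/-- The same headline from the WEAKER, faithful β-hypothesis `BetaBoundsInInterval` (bounds only on `]0, γ₀]`, history
inside the interval, `γ ≤ γ₀`), as in `endStatementB_of_nodes_interval`. [cite: Balaban1989LargeFieldII, Thm 1 p.355 + p.391] -/
theorem endStatementBPrinted_of_nodesP_interval (w : WorldP) (hγ : 0 < w.γ) {γ₀ : ℝ} (hγ₀ : w.γ ≤ γ₀)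
    (hnodes : ∀ P, Nodes (leavesP w P)) (hrg : ∀ P, (leavesP w P).rgFlow)
    (hβ : BetaBoundsInInterval w.C.toB12 γ₀ w.b w.βup) : B16.EndStatementBPrinted w.C := by
  refine endStatementBPrinted_of_worldsP w hγ fun P => uvStability_of_nodes (leavesP w P) (hnodes P) ?_
  intro hsc
  obtain ⟨hlo, hhi⟩ := alongRun_of_inInterval w.C.toB12 hβ hγ₀ P hsc
  exact flowIneq26_of_alongRun (w.withConsts 0 0) P (hrg P) hhi hlo fun k hk => (hsc k hk).1

/-- The unconditional §2 form in Theorem 2's regime, on the pin: thirteen nodes at the `leavesP` binding + (0.20) +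
`BetaBoundsInInterval γ₀ b β⁺` + `EndpointExistence` ⇒ `B16.Sect2Unconditional w.C` ∧ [III] Cor. 3 (2.50) — the (0.1)-half
is delivered in Cor. 3's printed dependence ("depending on g_k"), NOT run-uniformly (contrast `sect2Unconditional_of_nodes`,
whose run-uniform (0.1)-half rests on the stronger reading). [cite: Balaban1989LargeFieldII, p.355] -/
theorem sect2Unconditional_of_nodesP (w : WorldP) (hγ : 0 < w.γ) {γ₀ : ℝ} (hγ₀ : w.γ ≤ γ₀) (hbup : w.b ≤ w.βup)
    (hnodes : ∀ P, Nodes (leavesP w P)) (hrg : ∀ P, (leavesP w P).rgFlow)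
    (hβ : BetaBoundsInInterval w.C.toB12 γ₀ w.b w.βup) (hex : EndpointExistence w.C.toB12) :
    B16.Sect2Unconditional w.C ∧ B16.Cor3_250 w.C := by
  have hB : B16.EndStatementBPrinted w.C := endStatementBPrinted_of_nodesP_interval w hγ hγ₀ hnodes hrg hβ
  have h2 : B16.Thm2Shape w.C w.L :=
    thm2Shape_of_world (w.withConsts 0 0) (lt_of_lt_of_le hγ hγ₀) hbup (fun P => hrg P) hβ hex
  exact ⟨B16.sect2_unconditional_of_Thm2 w.C w.L hB.1 h2, hB.2⟩

/-- By-name twins on the constant-exponent binding: its END theorems reach the pin through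
`B16.endStatementBPrinted_of_endStatementB` (the stronger reading implies the pin; see the honesty note of this section on
when their hypotheses can hold at all). [cite: Balaban1989LargeFieldII, Thm 1 p.355 + p.391] -/
theorem endStatementBPrinted_of_worlds (w : World) (hγ : 0 < w.γ) (h : ∀ P, Dag.UVStability4D (leaves w P)) :
    B16.EndStatementBPrinted w.C :=
  B16.endStatementBPrinted_of_endStatementB w.C (endStatementB_of_worlds w hγ h)

/-- Twin of `endStatementB_of_nodes` concluding the pin. [cite: Balaban1989LargeFieldII, Thm 1 p.355 + p.391] -/
theorem endStatementBPrinted_of_nodes (w : World) (hγ : 0 < w.γ) (hnodes : ∀ P, Nodes (leaves w P))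
    (hrg : ∀ P, (leaves w P).rgFlow) (hsb : ∀ P, (leaves w P).betaSmoothBounded)
    (hpos : ∀ P, (leaves w P).betaPositive) : B16.EndStatementBPrinted w.C :=
  B16.endStatementBPrinted_of_endStatementB w.C (endStatementB_of_nodes w hγ hnodes hrg hsb hpos)

/-- Twin of `endStatementB_of_nodes_interval` concluding the pin. [cite: Balaban1989LargeFieldII, Thm 1 p.355 + p.391] -/
theorem endStatementBPrinted_of_nodes_interval (w : World) (hγ : 0 < w.γ) {γ₀ : ℝ} (hγ₀ : w.γ ≤ γ₀)
    (hnodes : ∀ P, Nodes (leaves w P)) (hrg : ∀ P, (leaves w P).rgFlow)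
    (hβ : BetaBoundsInInterval w.C.toB12 γ₀ w.b w.βup) : B16.EndStatementBPrinted w.C :=
  B16.endStatementBPrinted_of_endStatementB w.C (endStatementB_of_nodes_interval w hγ hγ₀ hnodes hrg hβ)

/-- WHEN THE CONSTANT-EXPONENT HYPOTHESES CAN HOLD AT ALL (the honesty note, kernel-checked, CONDITIONAL): under the two
READER'S HYPOTHESES of `…B16B10Shape` — `LogNormalised` on every interval (the step-0 logarithm with family-uniform
constants: pv24's reading of the normalisation of ρ₀, cell GAPS G-pv24-1 (i)–(iii) OPEN, not a printed theorem) and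
`SmallCouplingsOccur` in every interval (arbitrarily small bare couplings) — (B) CANNOT hold at the constant-exponent binding
for every run of any world on `C` with `γ > 0`, by `B16B10Shape.not_uvBound01_of_smallCouplings`.  So for `C` satisfying
those hypotheses the END theorems over `World` have jointly unsatisfiable hypotheses, and the `WorldP` headline is the one
that can carry content; whether Bałaban's constructions satisfy `LogNormalised` is the reader's open item, not decided here.
v10.2a POINTER (docstring only; pv24-g4 NOTE 2026-08-19T00:44:24Z, cell GAPS C-pv24g4-1; KERNEL facts of the landed and
cross-read siblings `…B16SmallCouplings` v1.1 (XREAD ok b02-g9, pv15-g4) and `…B16LeafFamily` v1 (XREAD ok pv22-g6), both of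
which import this module through `…FlowStepRuns`, so the pointer cannot be a by-name theorem here).  THE PAIR AS TYPED IS
MIS-CUT AT K = 0: on every forward-generated construction (`ForwardGenerated`, first clause `g_0 = g₀`) with non-empty
lattices, `hsmall` holds by ZERO-STEP runs (`B16SmallCouplings.smallCouplingsOccur_of_forwardGenerated`), while `hnorm` is
UNSATISFIABLE as soon as the zero-step densities are bounded by 1 (`B16SmallCouplings.not_logNormalised_of_zeroStep`,
`…logNormalised_family_unsatisfiable`) — there this theorem holds vacuously.  ITS NON-VACUOUS FORM is
`B16SmallCouplings.not_forall_uvStability4D_leaves_of_betaUpper` (same conclusion `¬ ∀ P, Dag.UVStability4D (leaves w P)`;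
ONE reader's hypothesis `B16SmallCouplings.LogNormalisedFrom w.C w.γ c C₀ K₀` — the step-0 logarithm asked only of the runs
of the ]0, w.γ]-family with at least K₀ steps —, for `w.C` forward-generated with `β ≤ w.βup` on a box family
(`FlowStep.BetaUpperH`, [Balaban1987RG1] p. 264) and non-empty lattices; `Construction` form
`B16SmallCouplings.not_uvBound01_of_betaUpper`), with the K₀ = 1 logarithm DERIVED from located leaves in
`B16SmallCouplings.not_uvBound01_of_leaves` and that leaf family INSTANTIATED from the series' data (the periodic lattices
(0.1) [Balaban1987RG1] p. 251, the (1.15) [Balaban1988Convergent] p. 249 constants, the (0.15) [Balaban1987RG1]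
normalisation on SU(N)) in `B16LeafFamily.not_uvBound01_of_torusLeaves`, whose remaining undischarged inputs are the
reader's items `ρ₀(V₁) ≥ e^{−E}` on one configuration and `EflBound` (author question (ii) of cell GAPS G-pv24-1, OPEN).
Nothing printed is asserted by either sibling; whether Bałaban's densities satisfy the K-indexed logarithm stays the
reader's open item; this theorem and every other declaration of this module are UNCHANGED by v10.2a. [folklore] -/
theorem not_forall_uvStability4D_leaves_of_smallCouplings (w : World) (hγ : 0 < w.γ) (c : ℝ) (C₀ : ℝ → ℝ) (hc : 0 < c)
    (hnorm : ∀ γ : ℝ, 0 < γ → B16B10Shape.LogNormalised w.C γ c (C₀ γ))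
    (hsmall : ∀ γ : ℝ, 0 < γ → B16B10Shape.SmallCouplingsOccur w.C γ) :
    ¬ ∀ P, Dag.UVStability4D (leaves w P) := fun h =>
  B16B10Shape.not_uvBound01_of_smallCouplings w.C c C₀ hc hnorm hsmall (endStatementB_of_worlds w hγ h).2

/-! ## (v8) The B6 leaf with the constant of Lemma 2.1 a PARAMETER — cell GAPS G-ref1-11 (REFEREE R28), G-A11-1 / G-A12-1

`Upstream.ofPrinted` (hence `ofPrintedR` / `ofPrintedFull` / `ofPrintedAll` / `ofPrintedAllX`) binds `b6 := B6.StatedBlock X.D6`,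
whose first conjunct `B6.Lemma21Printed` carries (2.61) with the LITERAL constant `B6.c1 d δ₀ α = 12·c₀(½α)^d`
([Balaban1984PropagatorsII] Lemma 2.1 p. 234).  The sibling `…B6Lemma21Counterexample` proves (`printed_c1_exceeded`) that
on every d = 4 geometry carrying its slab-witness family the (2.61) row sum EXCEEDS that constant at αδ₀ = 1/8 — so on those
geometries `Ineq261`, `Lemma21Printed`, `StatedBlock` and the bound leaf `b6` are FALSE AS TYPED and every bookkeeping
implication routed through `b6` is vacuous there (no declaration is wrong; a LEAF is refuted-as-typed).  What all consumers
of Lemma 2.1 use is (2.61)–(2.63) with SOME constant depending on d, δ₀, α only (uniform over the geometries); the sibling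
`…B6Lemma21Repaired` types the displays with a generic constant (`Ineq261With c`) and the REPAIRED statement
`Lemma21Repaired` (c₁′ = 13·c₀(½α)^{3d} = `B6Lemma21Arith.c1Repaired`, GAPS G-A12-1).  This section offers, additively:
the PARAMETER form of the Lemma 2.1 conjunct (`B6Lemma21Param`: ∃ c₁(·), uniform in the geometry index), the block with that
conjunct (`B6BlockParam`) and with the repaired conjunct (`B6BlockRepaired`), the exact relations printed ⇒ repaired-shape ⇒
parameter (direction of constants only; the printed antecedent is the settled NEGATIVE edge for d ≥ 3), and the re-bound
upstream `Upstream.withB6` / `Upstream.ofPrintedAllXP`.  The literal-constant declarations stay on file unchanged. -/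

/-- The stated block of B6 WITHOUT its Lemma 2.1 conjunct: Prop. 2.2 ∧ Prop. 2.3 ∧ Lemma 2.4 ∧ Prop. 2.5 ∧ Prop. 2.6 ∧
Prop. 2.7 ∧ Cor. 2.8, verbatim the remaining conjuncts of `B6.StatedBlock`. [cite: Balaban1984PropagatorsII, pp.223–250] -/
def B6BlockRest (D : B6.BlockData) : Prop :=
  B6.Prop22Printed D.geo D.Gp ∧ B6.Prop23Printed D.d D.geo D.Cinv ∧
  B6.Lemma24Printed D.d D.L D.tree ∧ B6.Prop25Printed D.loc ∧ B6.Prop26Printed D.geo D.G ∧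
  B6.Prop27Printed D.d D.geo D.Qinv ∧ B6.Cor28Printed D.d D.geo D.H

/-- Kernel check (`Iff.rfl`) that the split is verbatim: `B6.StatedBlock D` IS `Lemma21Printed ∧ B6BlockRest D`. [folklore] -/
theorem statedBlock_iff_lemma21_and_rest (D : B6.BlockData) :
    B6.StatedBlock D ↔ B6.Lemma21Printed D.d D.δ₀ D.geo ∧ B6BlockRest D := Iff.rfl

/-- **Lemma 2.1 with its constant a PARAMETER** (the shape cell GAPS G-ref1-11 requires): there is a function `c₁` of α —
for the block's fixed d, δ₀, and UNIFORM over the family of geometries `i : D.I` — such that for every geometry satisfying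
(2.1)–(2.2), every 0 < α < 1 and RM satisfying (2.59): (2.60) ∧ (2.61) with the constant `c₁ α` ((2.62)–(2.63) then follow
for the same constant, `B6Lemma21Repaired.ineq262With_of_261With` / `ineq263With_of_261With`).  A claim under adjudication,
typed as a proposition, never asserted.  CONTENT NOTE (v8.1, from the v8 gate review): when the index type `D.I` is FINITE
the existential over `c₁` is cheap (the reviewer's remark: each (2.61) row sum is then one of finitely many quantities and
`c₁ α :=` their maximum works, exactly as for `B6Lemma21Repaired.Lemma21Repaired`), so the Prop then carries only (2.60);
its Lemma-2.1 content is the UNIFORMITY of the constant over an INFINITE family of geometries (all scales, volumes and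
block sequences of [Balaban1984PropagatorsII] Sect. A), which is how consumers must instantiate `D.I`.
[cite: Balaban1984PropagatorsII, Lemma 2.1 (2.60)–(2.61) p.234] -/
def B6Lemma21Param (D : B6.BlockData) : Prop :=
  ∃ c₁ : ℝ → ℝ, ∀ i : D.I, (D.geo i).Hyp21_22 → ∀ α : ℝ, 0 < α → α < 1 →
    B6.Cond259 D.d D.δ₀ α (D.geo i).R (D.geo i).M →
      B6RandomWalk.Ineq260 (D.geo i) D.δ₀ α ∧ B6Lemma21Repaired.Ineq261With (c₁ α) (D.geo i) D.δ₀ α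

/-- The stated block of B6 with Lemma 2.1 in PARAMETER form. [cite: Balaban1984PropagatorsII, pp.223–250] -/
def B6BlockParam (D : B6.BlockData) : Prop := B6Lemma21Param D ∧ B6BlockRest D

/-- The stated block of B6 with Lemma 2.1 in its REPAIRED form `B6Lemma21Repaired.Lemma21Repaired` (c₁′ = 13·c₀(½α)^{3d};
cell GAPS G-A12-1 — the statement the repaired p. 233 argument supports; its analytic leaf (2.61′) is NOT formalised, see
that module's docstring). [cite: Balaban1984PropagatorsII, Lemma 2.1 p.234; repaired] -/
def B6BlockRepaired (D : B6.BlockData) : Prop :=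
  B6Lemma21Repaired.Lemma21Repaired D.d D.δ₀ D.geo ∧ B6BlockRest D

/-- The repaired Lemma 2.1 gives the parameter form (witness `c₁ = c1Repaired d δ₀`). [folklore] -/
theorem b6Lemma21Param_of_repaired (D : B6.BlockData) (h : B6Lemma21Repaired.Lemma21Repaired D.d D.δ₀ D.geo) :
    B6Lemma21Param D :=
  ⟨fun α => B6Lemma21Arith.c1Repaired D.d D.δ₀ α, fun i hH α hα0 hα1 hcond => h i hH α hα0 hα1 hcond⟩

/-- The printed Lemma 2.1 would give the parameter form (witness the literal `c₁ = B6.c1 d δ₀`).  Recorded ONLY to fix the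
direction of the constants: the antecedent is refuted as typed for d ≥ 3 on the witness geometries
(`B6Lemma21Counterexample.printed_c1_exceeded`, cell GAPS G-A11-1) — the settled NEGATIVE edge. [folklore] -/
theorem b6Lemma21Param_of_printed (D : B6.BlockData) (h : B6.Lemma21Printed D.d D.δ₀ D.geo) : B6Lemma21Param D :=
  ⟨fun α => B6.c1 D.d D.δ₀ α, fun i hH α hα0 hα1 hcond =>
    (B6RandomWalk.lemma21Printed_iff D.d D.δ₀ D.geo).mp h i hH α hα0 hα1 hcond⟩

/-- Block level: repaired ⇒ parameter form. [folklore] -/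
theorem b6BlockParam_of_repaired (D : B6.BlockData) (h : B6BlockRepaired D) : B6BlockParam D :=
  ⟨b6Lemma21Param_of_repaired D h.1, h.2⟩

/-- Block level: printed (literal constant) ⇒ parameter form — vacuous for d ≥ 3 on the witness geometries (G-A11-1);
never conversely. [folklore] -/
theorem b6BlockParam_of_statedBlock (D : B6.BlockData) (h : B6.StatedBlock D) : B6BlockParam D :=
  ⟨b6Lemma21Param_of_printed D h.1, ((statedBlock_iff_lemma21_and_rest D).mp h).2⟩

/-- The parameter-form block still contains B6's "main technical results" (Prop. 2.6 ∧ Cor. 2.8, p. 249), the sub-block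
the B9 base imports. [cite: Balaban1984PropagatorsII, p.249] -/
theorem b6BlockParam_mainResults (D : B6.BlockData) (h : B6BlockParam D) : B6.MainResults D :=
  ⟨h.2.2.2.2.2.1, h.2.2.2.2.2.2.2⟩

/-- With the parameter form, (2.62) and (2.63) hold for the SAME constant (the printed "hence", generic in the constant;
(2.63) uses the triangle inequality (2.54) and δ₀ ≥ 0). [cite: Balaban1984PropagatorsII, Lemma 2.1 (2.62)–(2.63) p.234] -/
theorem b6Lemma21Param_full (D : B6.BlockData) (hδ : 0 ≤ D.δ₀) (htri : ∀ i, B6RandomWalk.Triangle254 (D.geo i))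
    (h : B6Lemma21Param D) :
    ∃ c₁ : ℝ → ℝ, ∀ i : D.I, (D.geo i).Hyp21_22 → ∀ α : ℝ, 0 < α → α < 1 →
      B6.Cond259 D.d D.δ₀ α (D.geo i).R (D.geo i).M →
        B6RandomWalk.Ineq260 (D.geo i) D.δ₀ α ∧ B6Lemma21Repaired.Ineq261With (c₁ α) (D.geo i) D.δ₀ α ∧
          B6Lemma21Repaired.Ineq262With (c₁ α) (D.geo i) D.δ₀ α ∧ B6Lemma21Repaired.Ineq263With (c₁ α) (D.geo i) D.δ₀ α := by
  obtain ⟨c₁, hc⟩ := h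
  refine ⟨c₁, fun i hH α hα0 hα1 hcond => ?_⟩
  obtain ⟨h260, h261⟩ := hc i hH α hα0 hα1 hcond
  exact ⟨h260, h261, B6Lemma21Repaired.ineq262With_of_261With h261,
    B6Lemma21Repaired.ineq263With_of_261With (htri i) hδ hα1.le h261⟩

/-- Re-binding ONE leaf: the upstream `u` with its `b6` slot replaced by the proposition `b6` (all other leaves unchanged,
`rfl`). [folklore] -/
def Upstream.withB6 (u : Upstream) (b6 : Prop) : Upstream :=
  { u with b6 := b6 }

/-- Bookkeeping (`rfl`): the re-bound leaf and the untouched ones. [folklore] -/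
theorem withB6_leaves (u : Upstream) (b6 : Prop) :
    (u.withB6 b6).b6 = b6 ∧ (u.withB6 b6).b4 = u.b4 ∧ (u.withB6 b6).b5 = u.b5 ∧ (u.withB6 b6).b7 = u.b7 ∧
    (u.withB6 b6).b8 = u.b8 ∧ (u.withB6 b6).b9 = u.b9 ∧ (u.withB6 b6).b10 = u.b10 ∧ (u.withB6 b6).b11 = u.b11 ∧
    (u.withB6 b6).b12 = u.b12 ∧ (u.withB6 b6).b13 = u.b13 ∧ (u.withB6 b6).rOperation = u.rOperation ∧
    (u.withB6 b6).rBasicStep = u.rBasicStep :=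
  ⟨rfl, rfl, rfl, rfl, rfl, rfl, rfl, rfl, rfl, rfl, rfl, rfl⟩

/-- **The parameter-free binding with the B6 leaf in PARAMETER form** (cell GAPS G-ref1-11): `Upstream.ofPrintedAllX` with
`b6 := B6BlockParam X.D6` — Lemma 2.1 with ∃ c₁(α) uniform over the geometries, the other seven B6 statements verbatim.
[cite: Balaban1984PropagatorsII, Lemma 2.1 p.234] -/
def Upstream.ofPrintedAllXP (X : PrintedCarriersR) (Y : PrintedCarriers9X) (Z : PrintedCarriers11)
    (V : PrintedCarriers14R) (W : PrintedCarriers15) : Upstream :=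
  (Upstream.ofPrintedAllX X Y Z V W).withB6 (B6BlockParam X.D6)

/-- Bookkeeping (`rfl`): the leaves of the P-binding — `b6` is the parameter-form block, every other leaf is the
X-binding's. [cite: Balaban1984PropagatorsII, Lemma 2.1 p.234] -/
theorem ofPrintedAllXP_leaves (X : PrintedCarriersR) (Y : PrintedCarriers9X) (Z : PrintedCarriers11)
    (V : PrintedCarriers14R) (W : PrintedCarriers15) :
    (Upstream.ofPrintedAllXP X Y Z V W).b6 = B6BlockParam X.D6 ∧
    (Upstream.ofPrintedAllXP X Y Z V W).b4 = (Upstream.ofPrintedAllX X Y Z V W).b4 ∧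
    (Upstream.ofPrintedAllXP X Y Z V W).b5 = (Upstream.ofPrintedAllX X Y Z V W).b5 ∧
    (Upstream.ofPrintedAllXP X Y Z V W).b7 = (Upstream.ofPrintedAllX X Y Z V W).b7 ∧
    (Upstream.ofPrintedAllXP X Y Z V W).b8 = (Upstream.ofPrintedAllX X Y Z V W).b8 ∧
    (Upstream.ofPrintedAllXP X Y Z V W).b9 = B9LeafX Y ∧
    (Upstream.ofPrintedAllXP X Y Z V W).b10 = (Upstream.ofPrintedAllX X Y Z V W).b10 ∧
    (Upstream.ofPrintedAllXP X Y Z V W).b11 = B11Leaf Z ∧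
    (Upstream.ofPrintedAllXP X Y Z V W).b12 = (Upstream.ofPrintedAllX X Y Z V W).b12 ∧
    (Upstream.ofPrintedAllXP X Y Z V W).b13 = (Upstream.ofPrintedAllX X Y Z V W).b13 ∧
    (Upstream.ofPrintedAllXP X Y Z V W).rOperation = ROpLeaf V ∧
    (Upstream.ofPrintedAllXP X Y Z V W).rBasicStep = B15Leaf W :=
  ⟨rfl, rfl, rfl, rfl, rfl, rfl, rfl, rfl, rfl, rfl, rfl, rfl⟩

/-- The literal-constant binding's `b6` leaf implies the P-binding's (never conversely; vacuous for d ≥ 3 on the witness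
geometries, G-A11-1). [folklore] -/
theorem ofPrintedAllXP_b6_of_ofPrintedAllX (X : PrintedCarriersR) (Y : PrintedCarriers9X) (Z : PrintedCarriers11)
    (V : PrintedCarriers14R) (W : PrintedCarriers15) (h : (Upstream.ofPrintedAllX X Y Z V W).b6) :
    (Upstream.ofPrintedAllXP X Y Z V W).b6 :=
  b6BlockParam_of_statedBlock X.D6 h

/-- The repaired block implies the P-binding's `b6` leaf. [folklore] -/
theorem ofPrintedAllXP_b6_of_repaired (X : PrintedCarriersR) (Y : PrintedCarriers9X) (Z : PrintedCarriers11)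
    (V : PrintedCarriers14R) (W : PrintedCarriers15) (h : B6BlockRepaired X.D6) :
    (Upstream.ofPrintedAllXP X Y Z V W).b6 :=
  b6BlockParam_of_repaired X.D6 h

/-- The P-binding's `b6` leaf still delivers B6's main results (Prop. 2.6 ∧ Cor. 2.8) for the B9 base. [cite: Balaban1984PropagatorsII, p.249] -/
theorem ofPrintedAllXP_b6_mainResults (X : PrintedCarriersR) (Y : PrintedCarriers9X) (Z : PrintedCarriers11)
    (V : PrintedCarriers14R) (W : PrintedCarriers15) (h : (Upstream.ofPrintedAllXP X Y Z V W).b6) :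
    B6.MainResults X.D6 :=
  b6BlockParam_mainResults X.D6 h


/-! ## (v9) The `rOperation` leaf over the INHABITED step carrier `Step.DensityRGI`

Cell FOUNDATIONS audit (Setup v1.3, f1 gen 6; `…AveragingRT`): the renormalization-transformation record `RTOp` is
UNINHABITED as typed for a non-degenerate Haar datum (`AveragingRT.isEmpty_rtOp_family`), so every statement binding
`(D : Step.DensityRG P G av)` — among them v6's `ROpLeaf.mapsSpaces` above — is a correct implication over an EMPTY carrier
there (vacuous-as-typed; no declaration is wrong).  The Step side re-types the density sequence (0.2) over the inhabited
carrier `RTOpI` (`Step.DensityRGI`, module `…StepInhabited`, f2 gen 7; bridges `Step.DensityRG.toI_*`), and its MIGRATION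
note names `DagBinding.ROpLeaf.mapsSpaces` among the consumers to re-state.  This section does exactly that and nothing
else: the bound `rOperation` leaf (`ROpLeaf V` = [Balaban1988Convergent] p. 244 *"we will only assume that it has some
properties incorporated in the inductive description of the effective actions"*, typed `B14.RAssumedP244`) is consumed over
`Step.DensityRGI` to give the step on spaces `Step.DensityRGI.MapsSpaces` (p. 262 *"the operation 𝐑T transforms the space
with the index k into the space with the index k+1"*), with the p. 245 Theorem (space reading) hypothesis written over the
step maps `(D.T k).T` — verbatim the body of `B14.ThmP245Spaces`, which is itself typed over the old `RTOp` family.  (At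
the time of writing, v9, its inhabited form was the B14 lineage's pending migration item and was deliberately not restated
here; it has since landed as `B14.ThmP245SpacesI` in `…B14` v4, and §(v10) below consumes it BY NAME — the written-out
hypothesis of `ROpLeaf.mapsSpacesI` IS that statement, `ROpLeaf.thmP245SpacesI_iff`.)  Pure logic; nothing of the series
is asserted.  `ROpLeaf.mapsSpaces` stays on file unchanged (importers), and `ROpLeaf.mapsSpaces_of_toI` shows it
is the `DensityRG.toI` shadow of the new theorem. -/

/-- The bound `rOperation` leaf consumed over the INHABITED step carrier: for a `Step.DensityRGI` datum whose large-field
operations are the carrier's `R`, the p. 245 Theorem in its space reading for the step maps `(D.T k).T` (hypothesis `hT`,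
the body of `B14.ThmP245Spaces` over `RTOpI`) and the assumed 𝐑 (`ROpLeaf V`) give *"the operation 𝐑T transforms the
space with the index k into the space with the index k+1"* (`Step.DensityRGI.MapsSpaces`).  Pure logic. [cite: Balaban1988Convergent, Theorem p.245 with remark p.262] -/
theorem ROpLeaf.mapsSpacesI (V : PrintedCarriers14R) {av : ∀ j, Averaging V.P j V.G}
    (D : Step.DensityRGI V.P V.G av) (hR : ∀ k ρ, D.R k ρ = V.R k ρ)
    (hT : ∀ k, k < V.K → ∀ ρ : Density V.P k V.G, V.S k ρ → V.Scorr (k + 1) ((D.T k).T ρ))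
    (h : ROpLeaf V) : D.MapsSpaces V.S V.K := by
  intro k hk ρ hS
  rw [hR]
  exact h k hk _ (hT k hk ρ hS)

/-- Bridge to v6: for an old-carrier datum `D : Step.DensityRG`, the hypothesis of `ROpLeaf.mapsSpacesI` at `D.toI` is
`B14.ThmP245Spaces D.T …` verbatim (`Step.DensityRG.toI_T_T`) and its conclusion is `D.MapsSpaces`
(`Step.DensityRG.toI_mapsSpaces_iff`) — so `ROpLeaf.mapsSpaces` is the `toI` shadow of the inhabited-carrier theorem.
Pure logic. [folklore] -/
theorem ROpLeaf.mapsSpaces_of_toI (V : PrintedCarriers14R) {av : ∀ j, Averaging V.P j V.G}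
    (D : Step.DensityRG V.P V.G av) (hR : ∀ k ρ, D.R k ρ = V.R k ρ)
    (hT : B14.ThmP245Spaces D.T V.S V.Scorr V.K) (h : ROpLeaf V) : D.MapsSpaces V.S V.K :=
  (Step.DensityRG.toI_mapsSpaces_iff D V.S V.K).1
    (ROpLeaf.mapsSpacesI V D.toI hR (fun k hk ρ hS => hT k hk ρ hS) h)

/-- The induction along (0.2) over the inhabited carrier, at the bound leaf: a start in the index-0 space, the p. 245
Theorem (space reading, step maps) and the assumed 𝐑 put `ρ_k` in the index-k space for every `k ≤ K`
(`Step.DensityRGI.inSpace_all`).  Pure logic. [cite: Balaban1988Convergent, Thm 1 p.262 with Theorem p.245] -/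
theorem ROpLeaf.inSpace_allI (V : PrintedCarriers14R) {av : ∀ j, Averaging V.P j V.G}
    (D : Step.DensityRGI V.P V.G av) (hR : ∀ k ρ, D.R k ρ = V.R k ρ)
    (h0 : V.S 0 (D.ρ 0))
    (hT : ∀ k, k < V.K → ∀ ρ : Density V.P k V.G, V.S k ρ → V.Scorr (k + 1) ((D.T k).T ρ))
    (h : ROpLeaf V) : ∀ k, k ≤ V.K → V.S k (D.ρ k) :=
  D.inSpace_all V.S V.K h0 (ROpLeaf.mapsSpacesI V D hR hT h)


/-! ## (v10) The `rOperation` leaf over the inhabited carrier, BY NAME (`B14.ThmP245SpacesI`, `…B14` v4)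

`…B14` v4 (B14 lineage; the B14 row of the Setup v1.3∕v1.4 MIGRATION table) types the p. 245 Theorem over the inhabited
carrier: `B14.ThmP245SpacesI T S Scorr K := ∀ k, k < K → ∀ ρ, S k ρ → Scorr (k+1) ((T k).T ρ)` for
`T : (k : ℕ) → RTOpI P k G (av k)`, with the p. 262 remark `B14.mapsSpaces_of_thmP245SpacesI` and the induction
`B14.inSpace_all_of_thmP245SpacesI` over `Step.DensityRGI`.  The hypothesis `hT` written out in v9's `ROpLeaf.mapsSpacesI` IS
that statement (`ROpLeaf.thmP245SpacesI_iff`, definitional), and the two theorems below are the exact `…I` twins of v6's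
`ROpLeaf.mapsSpaces`: the bound leaf `ROpLeaf V` (p. 244 assumed 𝐑) supplies B14's `RAssumedP244` hypothesis once the
datum's large-field operations are the carrier's (`hR`).  Pure logic; nothing of the series is asserted. -/

/-- v9's written-out p. 245 hypothesis over the step maps IS `B14.ThmP245SpacesI D.T V.S V.Scorr V.K` (definitional).
[folklore] -/
theorem ROpLeaf.thmP245SpacesI_iff (V : PrintedCarriers14R) {av : ∀ j, Averaging V.P j V.G}
    (D : Step.DensityRGI V.P V.G av) :
    B14.ThmP245SpacesI D.T V.S V.Scorr V.K ↔
      (∀ k, k < V.K → ∀ ρ : Density V.P k V.G, V.S k ρ → V.Scorr (k + 1) ((D.T k).T ρ)) :=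
  Iff.rfl

/-- The bound `rOperation` leaf consumed over the inhabited carrier through B14's kernel-checked p. 262 remark: with the
p. 245 Theorem (space reading, `B14.ThmP245SpacesI`) for the step maps of a `Step.DensityRGI` datum whose 𝐑 is the
carrier's `R`, *"the operation 𝐑T transforms the space with the index k into the space with the index k+1"*
(`B14.mapsSpaces_of_thmP245SpacesI`).  The `…I` twin of `ROpLeaf.mapsSpaces`. [cite: Balaban1988Convergent, Theorem p.245 with remark p.262] -/
theorem ROpLeaf.mapsSpaces_of_thmP245SpacesI (V : PrintedCarriers14R) {av : ∀ j, Averaging V.P j V.G}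
    (D : Step.DensityRGI V.P V.G av) (hR : ∀ k ρ, D.R k ρ = V.R k ρ)
    (hT : B14.ThmP245SpacesI D.T V.S V.Scorr V.K) (h : ROpLeaf V) : D.MapsSpaces V.S V.K :=
  B14.mapsSpaces_of_thmP245SpacesI D hT (by
    intro k hk ρ' hρ
    rw [hR]
    exact h k hk ρ' hρ)

/-- The induction along (0.2) over the inhabited carrier through B14's `inSpace_all_of_thmP245SpacesI`: a start in the
index-0 space, the p. 245 Theorem (`B14.ThmP245SpacesI`) and the bound leaf put `ρ_k` in the index-k space for every
`k ≤ K`.  Pure logic. [cite: Balaban1988Convergent, Thm 1 p.262 with Theorem p.245] -/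
theorem ROpLeaf.inSpace_all_of_thmP245SpacesI (V : PrintedCarriers14R) {av : ∀ j, Averaging V.P j V.G}
    (D : Step.DensityRGI V.P V.G av) (hR : ∀ k ρ, D.R k ρ = V.R k ρ) (h0 : V.S 0 (D.ρ 0))
    (hT : B14.ThmP245SpacesI D.T V.S V.Scorr V.K) (h : ROpLeaf V) : ∀ k, k ≤ V.K → V.S k (D.ρ k) :=
  B14.inSpace_all_of_thmP245SpacesI D h0 hT (by
    intro k hk ρ' hρ
    rw [hR]
    exact h k hk ρ' hρ)

/-! ## (v10b) The parameter-form `b6` leaf from the TWO-SCALE form of Lemma 2.1 (`…B6Lemma21TwoScale`)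

The adv1 lineage's two-scale READING of the count (2.58) in [Balaban1984PropagatorsII] Lemma 2.1 (cell GAPS G-A13-1: IF
the intermediate surface points y_l, y′_l of the contour decomposition (2.47) p. 231 may be fine-lattice sites, a surface
leg runs on two scales and its per-leg factor would be c₀(½α)^{2d} rather than the printed c₀(½α)^d; kernel witness FOR
THAT READING `B6Lemma21TwoScale.surfaceWitness_gt`, d = 4) is CONTESTED (cell GAPS G-ref1-18 ∕ G-ref1-19 (b), REFEREE.md
R40 ∕ R44: the print DEFINES Σ_j as the point set Λ_j∩Σ_j, p. 231 ll. 13–15, so the intermediate points are coarse sites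
and the printed per-point factor stands; the witness exceeds c₀^4 but not the repaired m = 1 term) — v10.2 records both
readings and takes NO side.  The reading comes with the statement `B6Lemma21TwoScale.Lemma21TwoScale` (constant
`c1TwoScale d δ₀ α = 13·c₀(½α)^{4d}`; certificate C-A13-1), which is WEAKER than the gen-7 repaired form
(`lemma21Repaired_imp_twoScale`) and has exactly the shape of `B6Lemma21Param`'s matrix, so the PARAMETER-form leaf of
§(v8b) absorbs it with witness `c₁ = c1TwoScale d δ₀` whichever reading prevails — nothing downstream of `b6` moves, and
no consumer of `b6` reads a constant.  Pure logic; nothing of the series is asserted. -/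

/-- The two-scale form of Lemma 2.1 gives the parameter form (witness `c₁ = c1TwoScale d δ₀`). [folklore] -/
theorem b6Lemma21Param_of_twoScale (D : B6.BlockData)
    (h : B6Lemma21TwoScale.Lemma21TwoScale D.d D.δ₀ D.geo) : B6Lemma21Param D :=
  ⟨fun α => B6Lemma21TwoScale.c1TwoScale D.d D.δ₀ α, fun i hH α hα0 hα1 hcond => h i hH α hα0 hα1 hcond⟩

/-- The parameter-form stated block from the two-scale form of Lemma 2.1 and the rest of the block. [folklore] -/
theorem b6BlockParam_of_twoScale (D : B6.BlockData) (h21 : B6Lemma21TwoScale.Lemma21TwoScale D.d D.δ₀ D.geo)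
    (hrest : B6BlockRest D) : B6BlockParam D :=
  ⟨b6Lemma21Param_of_twoScale D h21, hrest⟩

/-- The P-binding's `b6` leaf discharged from the two-scale form of Lemma 2.1 and the rest of B6's stated block. [folklore] -/
theorem ofPrintedAllXP_b6_of_twoScale (X : PrintedCarriersR) (Y : PrintedCarriers9X) (Z : PrintedCarriers11)
    (V : PrintedCarriers14R) (W : PrintedCarriers15) (h21 : B6Lemma21TwoScale.Lemma21TwoScale X.D6.d X.D6.δ₀ X.D6.geo)
    (hrest : B6BlockRest X.D6) : (Upstream.ofPrintedAllXP X Y Z V W).b6 :=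
  b6BlockParam_of_twoScale X.D6 h21 hrest

end Literature.MathematicalPhysics.QuantumFieldTheory.Balaban1983to89.DagBinding
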